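import Literature.NumberTheory.Transcendental.BrownLinearIndependence
import HarnessLib

/-!
# Brown, *Mixed Tate motives over ℤ* (2012) — §§3.1, 5, 6 from Goncharov's coaction formula:
# Lemma 3.4, Lemmas 5.3–5.6 and Theorem 6.1, i.e. `LevelData` from coaction data

Sibling file in the cone of the named fact
`Literature.NumberTheory.Transcendental.hoffmanSpan_eq_mzvSpace` (Brown 2012, Theorem 1.1 ⟹
Hoffman's Conjecture 2). `BrownLinearIndependence.lean` proves Theorem 7.4 (linear independence of
the Hoffman elements `ζᵐ(w)`, `w ∈ {2,3}^×`) and the named fact from `Brown2012.MotivicData`, whose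
level-data part ASSUMES the two results of §§5–6 about the operators `D_{2r+1}`:
the level lowering (Lemma 5.5, Lemma 3.4) and the shape `T_{N,ℓ} + E`, `E ∈ 2ℤ`, of the matrix of
`∂_{N,ℓ}` (Theorem 6.1 with (5.7)). This file DERIVES both from the formula by which Brown computes
— Goncharov's coaction in the infinitesimal form **(3.4)** —, i.e. it formalizes the combinatorial
heart of the paper: the analysis of the subsequences ("windows") of odd length `2r+1` of
`(0; ρ(w); 1)`, `ρ(2) = 10`, `ρ(3) = 100` (Definition 5.2), in the proofs of Lemma 3.4, Lemma 5.3,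
Lemma 5.5, Lemma 5.6 and Theorem 6.1.

## The input: `Brown2012.CoactionData`

A `ℚ`-vector space `H` with the motivic iterated integrals `J u = Iᵐ(0; u; 1)` (`u` a binary word;
(2.8)), general endpoints being reduced to these by the properties I0, I1, I3 of §2.4
(`Brown2012.Im`); for each `r ≥ 1` the linear functional `f r : H → ℚ` "coefficient of
`ζ_{2r+1} = π(ζᵐ(2r+1))`" ((5.5) composed with `π` and `p_{2r+1}`, Definitions 3.1, 5.7) and the
operator `D r = ((ζ_{2r+1} ↦ 1) ⊗ id) ∘ D_{2r+1} : H → H`; and the AXIOMS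
* `coaction` — (3.4): `D r (Iᵐ(0; v; 1)) = ∑_p f r (Iᵐ(a_p; a_{p+1}…a_{p+2r+1}; a_{p+2r+2})) •
  Iᵐ(0; quotient; 1)` (sum over the windows of `(0; v; 1) = a₀ a₁ ⋯ a_N a_{N+1}`)
  [Theorem 2.4 = Goncharov 2005, Theorem 1.2, in Brown's form (3.4)];
* `f_levelOne` — `f_{a+b+1} (ζᵐ(2^a 3 2^b)) = c_{2^a32^b} = zagierCoeff a b` [(3.12), from
  Theorem 3.3 / Corollary 3.6, with the value (4.2) of Theorem 4.3 = Zagier's theorem lifted];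
* `f_zetaOne` — `f_r (ζᵐ₁(2^r)) = c_{12^r} = 2(-1)^r` [(3.11)–(3.12) and Lemma 3.8];
* `J_rho_replicate_two_ne_zero` — `ζᵐ(2^n) ≠ 0` [Lemma 3.4 / (3.6)].

## What is proved (all words in Brown's order, `z w = ζᵐ(w) = J (ρ w)`)

* `CoactionData.lhs_sub_rhs_mem` — **Theorem 6.1 in exact word-level form** (with Lemmas 5.5, 5.6
  built in): for `w ∈ {2,3}^×`, `r ≥ 1`,
  `D r (ζᵐ(w)) ≡ ∑_{w = uvy, deg₃ v = 1, |v| = 2r+1} (c_v - [y ≠ ∅] c_{ṽ}) ζᵐ(uy)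
    + ∑_{w = u 3 2^r y} c_{12^r} ζᵐ(u 2 y) - ∑_{w = u 2^r 3 y} c_{12^r} ζᵐ(u 2 y)`
  modulo the `ζᵐ(u')` with `deg₃ u' ≤ deg₃ w - 2` — the four types of contributing windows of the
  proofs of Lemma 5.6 / Theorem 6.1 (type (3): `Iᵐ(0; ρ(v); 1) = ζᵐ(v)` and its right neighbour
  `Iᵐ(1; …; 0) = -ζᵐ(ṽ)` by I3, absent for the final window; type (2): `± ζᵐ₁(2^r)`), all other
  windows vanishing by I0 ("begins and ends in the same symbol") or having quotients of level
  `≤ deg₃ w - 2`. Proof by induction on `w`: the windows not starting inside the first block of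
  `ρ(w)` are the windows of the rest with the same endpoints and inner word (`lhs_cons`), and the
  `≤ 3` windows starting inside the first block are classified by hand
  (`wterm_zero_sub_gK1_mem`, `wterm_one_add_mem`, `wterm_two_sub_gT1_mem`). Checked against the
  worked example of §5.5 (row `ζᵐ(3,3,2,2)` of `M_{10,2}`: `C₁₂ ζᵐ(3,2,2)`,
  `(C₃₂ - C₂₃ + C₁₂₂) ζᵐ(3,2)`, `C₃₂₂ ζᵐ(3)`).
* `CoactionData.D_z_mem_span` — **Lemma 5.5** (with Lemma 5.3): `D_{2r+1}` lowers the level;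
  `CoactionData.D_z_replicate_two` — **Lemma 3.4**: `D_{2r+1} ζᵐ(2^n) = 0`.
* `trueEntry`, `Emat`, `trueEntry_sub_deconcEntry`, `Emat_small` — the matrix `M_{N,ℓ}` of (5.7)
  and **`E = M_{N,ℓ} - T_{N,ℓ}` has entries in `2ℤ`** (`μ(I) ⊆ 2ℤ`: Corollary 4.4 (1) for the pairs
  `c_v - c_{ṽ}`, Lemma 3.8 for `c_{12^r}`), `CoactionData.matrix_eq'` — Theorem 6.1 in the matrix
  form of `LevelData.matrix_eq`.
* `CoactionData.toLevelData`, `CoactionData.linearIndependent_hoffman` — hence `LevelData` and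
  **Theorem 7.4** from the coaction; `freeCoactionData` — the free model (`H = ℚ^{(binary words)}`,
  `D r` defined by (3.4)), showing that the axioms of `CoactionData` are jointly consistent; `MotivicCoactionData` (adding the period map (2.11)/(2.19) and
  the weight pieces `H_N` of dimension `≤ d_N`, (2.23)), `MotivicCoactionData.toMotivicData` and
  `hoffmanSpan_eq_mzvSpace_of_motivicCoactionData` — **the named fact from the coaction data**.

Thus the fact is now reduced to the standard structural facts about motivic multiple zeta values
(existence of `H` with `Iᵐ`, I0/I3, Goncharov–Brown coaction (3.4), the depth-one coefficients
(3.12)/(4.2)/Lemma 3.8, `ζᵐ(2)ⁿ ≠ 0`, the period map and `dim H_N ≤ d_N`), none of which Mathlib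
has; everything Brown does with them in §§5–7 is formal here. No named facts are introduced
(the structures are hypothesis bundles, D-0026).

## References

* F. Brown, *Mixed Tate motives over ℤ*, Ann. of Math. **175** (2012), 949–976: §2.4 (I0–I3,
  Theorem 2.4, (2.18)), §3.1 (3.4), Lemma 3.4, (3.8), (3.11)–(3.12), Lemma 3.8, Theorem 4.3,
  Definition 5.2, Lemmas 5.3, 5.5, 5.6, Definitions 5.7–5.9, (5.7), §5.5, Theorem 6.1,
  Corollary 6.2, Theorems 7.3, 7.4 (arXiv:1102.1312). [Brown2012]
* A. B. Goncharov, *Galois symmetries of fundamental groupoids and noncommutative geometry*, Duke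
  Math. J. **128** (2005), 209–284, Theorem 1.2. [Goncharov2005]
-/

namespace Literature.NumberTheory.Transcendental

namespace Brown2012

open MZV

/-! ### Brown's encoding `ρ : {2,3}^× → {0,1}^×` (Definition 5.2) -/

/-- `ρ` on a letter: `ρ(n) = 1 0^{n-1}` (`ρ(2) = 10`, `ρ(3) = 100`), `true` standing for Brown's
letter `1` and `false` for `0`. [cite: Brown2012, Definition 5.2] -/
def rhoLetter (n : ℕ) : List Bool := true :: List.replicate (n - 1) false

/-- Brown's map `ρ` (Definition 5.2), "the unique map such that `ρ(2) = 10` and `ρ(3) = 100`, which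
respects the concatenation product"; `ζᵐ(w) = Iᵐ(0; ρ(w); 1)`. [cite: Brown2012, Definition 5.2] -/
def rho : List ℕ → List Bool
  | [] => []
  | a :: w => rhoLetter a ++ rho w

/-- `ρ(∅) = ∅`. [folklore] -/
@[simp] theorem rho_nil : rho [] = [] := rfl

/-- `ρ(a w) = ρ(a) ρ(w)`. [folklore] -/
@[simp] theorem rho_cons (a : ℕ) (w : List ℕ) : rho (a :: w) = rhoLetter a ++ rho w := rfl

/-- `ρ` respects concatenation. [cite: Brown2012, Definition 5.2] -/
@[simp] theorem rho_append (u v : List ℕ) : rho (u ++ v) = rho u ++ rho v := by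
  induction u with
  | nil => simp
  | cons a u ih => simp [ih]

/-- `ρ(2) = 10`. [cite: Brown2012, Definition 5.2] -/
theorem rhoLetter_two : rhoLetter 2 = [true, false] := rfl

/-- `ρ(3) = 100`. [cite: Brown2012, Definition 5.2] -/
theorem rhoLetter_three : rhoLetter 3 = [true, false, false] := rfl

/-- `|ρ(n)| = n` for `n ≥ 1`. [folklore] -/
theorem length_rhoLetter {a : ℕ} (ha : 1 ≤ a) : (rhoLetter a).length = a := by
  simp [rhoLetter]; omega

/-- The letters of a Hoffman word are `≥ 1` (indeed `≥ 2`). [folklore] -/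
theorem two_le_of_isHoffman {w : List ℕ} (hw : IsHoffman w) {a : ℕ} (ha : a ∈ w) : 2 ≤ a := by
  rcases hw a ha with rfl | rfl <;> norm_num

/-- `|ρ(w)| = |w|` (the weight) for a Hoffman word. [cite: Brown2012, §3.3] -/
theorem length_rho {w : List ℕ} (hw : IsHoffman w) : (rho w).length = weight w := by
  induction w with
  | nil => simp [weight]
  | cons a w ih =>
    have ha : 2 ≤ a := two_le_of_isHoffman hw (by simp)
    have hw' : IsHoffman w := fun i hi => hw i (by simp [hi])
    rw [rho_cons, List.length_append, ih hw', length_rhoLetter (by omega), weight_cons]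

/-- `ρ(w)` starts with the letter `1`. [folklore] -/
theorem rho_eq_true_cons {w : List ℕ} (hw : w ≠ []) : ∃ t, rho w = true :: t := by
  cases w with
  | nil => exact absurd rfl hw
  | cons a w => exact ⟨_, rfl⟩

/-- `ρ` of the reversed word: `ρ(w̃) = 1 σ̃` where `ρ(w) = 1 σ` (used for I3). [folklore] -/
theorem rho_reverse {w : List ℕ} (hw : w ≠ []) :
    rho w.reverse = true :: ((rho w).tail).reverse := by
  induction w with
  | nil => exact absurd rfl hw
  | cons a w ih =>
    by_cases h : w = []
    · subst h
      simp [rhoLetter]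
    · rw [List.reverse_cons, rho_append, ih h, rho_cons, rho_cons, rho_nil, List.append_nil]
      obtain ⟨t, ht⟩ := rho_eq_true_cons h
      rw [ht]
      simp [rhoLetter]

/-- Reversal of `2^a 3 2^b` is `2^b 3 2^a`. [folklore] -/
theorem reverse_replicate_append_three (a b : ℕ) :
    (List.replicate a 2 ++ 3 :: List.replicate b 2).reverse = List.replicate b 2 ++ 3 :: List.replicate a 2 := by
  simp [List.reverse_append]

/-! ### Positions in `ρ(w)`: block boundaries -/

/-- The value of `ρ(w)` at the position `|w↾k| + j` inside the block of the `k`-th letter: `1` at the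
start of the block (`j = 0`), `0` inside it. [folklore] -/
theorem getElem?_rho_weight_take_add {w : List ℕ} (hw : IsHoffman w) {k : ℕ} (hk : k < w.length)
    {j : ℕ} (hj : j < w[k]) :
    (rho w)[weight (w.take k) + j]? = some (decide (j = 0)) := by
  have hwt : IsHoffman (w.take k) := fun i hi => hw i (List.mem_of_mem_take hi)
  have hρ : rho w = rho (w.take k) ++ (rhoLetter w[k] ++ rho (w.drop (k + 1))) := by
    rw [← rho_cons, ← rho_append]
    congr 1
    simp
  rw [hρ, List.getElem?_append_right (by rw [length_rho hwt]; omega), length_rho hwt,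
    Nat.add_sub_cancel_left, List.getElem?_append_left (by
      rw [length_rhoLetter (by have := two_le_of_isHoffman hw (List.getElem_mem hk); omega)]; exact hj)]
  cases j with
  | zero => simp [rhoLetter]
  | succ j =>
    simp only [rhoLetter, List.getElem?_cons_succ]
    rw [List.getElem?_replicate_of_lt (by omega)]
    simp

/-- `ρ(w)` splits at a block boundary: `ρ(w)↾|w↾k| = ρ(w↾k)`. [folklore] -/
theorem take_rho_weight_take {w : List ℕ} (hw : IsHoffman w) (k : ℕ) :
    (rho w).take (weight (w.take k)) = rho (w.take k) := by
  have hwt : IsHoffman (w.take k) := fun i hi => hw i (List.mem_of_mem_take hi)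
  have hρ : rho w = rho (w.take k) ++ rho (w.drop k) := by
    rw [← rho_append, List.take_append_drop]
  rw [hρ, List.take_left' (length_rho hwt)]

/-- … and the rest is `ρ` of the rest. [folklore] -/
theorem drop_rho_weight_take {w : List ℕ} (hw : IsHoffman w) (k : ℕ) :
    (rho w).drop (weight (w.take k)) = rho (w.drop k) := by
  have hwt : IsHoffman (w.take k) := fun i hi => hw i (List.mem_of_mem_take hi)
  have hρ : rho w = rho (w.take k) ++ rho (w.drop k) := by
    rw [← rho_append, List.take_append_drop]
  rw [hρ, List.drop_left' (length_rho hwt)]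

/-- Every position `m ≤ |w|` lies in a block: `m = |w↾k| + j` with `k ≤ |w|`, and `j < w_k` if
`k < |w|`, `j = 0` if `k = |w|`. [folklore] -/
theorem exists_block {w : List ℕ} (hw : IsHoffman w) {m : ℕ} (hm : m ≤ weight w) :
    ∃ k j, k ≤ w.length ∧ weight (w.take k) + j = m ∧
      (∀ hk : k < w.length, j < w[k]) ∧ (k = w.length → j = 0) := by
  induction w generalizing m with
  | nil =>
    refine ⟨0, 0, le_rfl, ?_, fun hk => absurd hk (by simp), fun _ => rfl⟩
    simp [weight] at hm ⊢; omega
  | cons a w ih =>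
    have hw' : IsHoffman w := fun i hi => hw i (by simp [hi])
    by_cases hma : m < a
    · exact ⟨0, m, Nat.zero_le _, by simp [weight], fun _ => by simpa using hma, fun h => by simp at h⟩
    · have hm' : m - a ≤ weight w := by rw [weight_cons] at hm; omega
      obtain ⟨k, j, hk, hkj, hj1, hj2⟩ := ih hw' hm'
      refine ⟨k + 1, j, by simpa using hk, ?_, fun hk' => ?_, fun hk' => hj2 (by simpa using hk')⟩
      · simp only [List.take_succ_cons, weight_cons]
        omega
      · have : k < w.length := by simpa using hk'
        simpa using hj1 this

/-- Prefix weights determine the prefix: `|w↾k| = |w↾k'|` forces `k = k'` when both are `≤ |w|`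
(letters are positive). [folklore] -/
theorem take_inj_of_weight_eq {w : List ℕ} (hw : IsHoffman w) {k k' : ℕ} (hk : k ≤ w.length)
    (hk' : k' ≤ w.length) (h : weight (w.take k) = weight (w.take k')) : k = k' := by
  by_contra hne
  wlog hlt : k < k' generalizing k k'
  · exact this hk' hk h.symm (Ne.symm hne) (by omega)
  have hsplit : w.take k' = w.take k ++ (w.drop k).take (k' - k) := by
    rw [← List.take_add]
    congr 1
    omega
  have hne' : (w.drop k).take (k' - k) ≠ [] := by
    intro h0
    have := congrArg List.length h0
    simp at this
    omega
  obtain ⟨b, hb⟩ := List.exists_mem_of_ne_nil _ hne'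
  have hb2 : 2 ≤ b := two_le_of_isHoffman hw (List.mem_of_mem_drop (List.mem_of_mem_take hb))
  have hpos : 0 < weight ((w.drop k).take (k' - k)) := by
    unfold weight
    exact lt_of_lt_of_le (by omega) (List.single_le_sum (fun _ _ => Nat.zero_le _) b hb)
  rw [hsplit] at h
  unfold weight at hpos h
  rw [List.sum_append] at h
  omega


/-- `ρ(c) = (1 0^{c-2}) 0` for `c ≥ 2`: the block ends in the letter `0`. [folklore] -/
theorem rhoLetter_eq_append_false {c : ℕ} (hc : 2 ≤ c) :
    rhoLetter c = (true :: List.replicate (c - 2) false) ++ [false] := by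
  rw [rhoLetter, List.cons_append, ← List.replicate_succ']
  congr 2
  omega

/-! ### Windows (subsequences) of `(0; v; 1)` and their quotient sequences ((3.4)) -/

/-- The augmented sequence `a₀ a₁ ⋯ a_N a_{N+1} = (0; v; 1)` of a word `v = a₁ ⋯ a_N`.
[cite: Brown2012, §3.1 (3.4)] -/
def aug (v : List Bool) : List Bool := false :: (v ++ [true])

/-- Left endpoint `a_p` of the window (subsequence of (3.4)) at position `p`.
[cite: Brown2012, §3.1 (3.4)] -/
def lft (v : List Bool) (p : ℕ) : Bool := (aug v).getD p false

/-- Right endpoint `a_{p+n+1}` of the window at `p` of inner length `n`. [cite: Brown2012, §3.1 (3.4)] -/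
def rgt (v : List Bool) (n p : ℕ) : Bool := (aug v).getD (p + n + 1) false

/-- Inner word `a_{p+1} ⋯ a_{p+n}` of the window at `p` of inner length `n`.
[cite: Brown2012, §3.1 (3.4)] -/
def inner (v : List Bool) (n p : ℕ) : List Bool := (v.drop p).take n

/-- The quotient sequence `a₁ ⋯ a_p a_{p+n+1} ⋯ a_N` of the window at `p` (its inner part; the
endpoints stay `0` and `1`). [cite: Brown2012, §3.1 (3.4)] -/
def quot (v : List Bool) (n p : ℕ) : List Bool := v.take p ++ v.drop (p + n)

/-- `a₀ = 0`. [folklore] -/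
@[simp] theorem lft_zero (v : List Bool) : lft v 0 = false := rfl

/-- `a_{p+1} = v_p`. [folklore] -/
theorem lft_succ {v : List Bool} {p : ℕ} (hp : p < v.length) : lft v (p + 1) = v[p] := by
  simp [lft, aug, List.getD_eq_getElem?_getD, List.getElem?_append_left hp,
    List.getElem?_eq_getElem hp]

/-- The right endpoint inside `v`. [folklore] -/
theorem rgt_of_lt {v : List Bool} {n p : ℕ} (h : p + n < v.length) : rgt v n p = v[p + n] := by
  simp [rgt, aug, List.getD_eq_getElem?_getD, List.getElem?_append_left h,
    List.getElem?_eq_getElem h]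

/-- The right endpoint `a_{N+1} = 1`. [folklore] -/
theorem rgt_of_eq {v : List Bool} {n p : ℕ} (h : p + n = v.length) : rgt v n p = true := by
  simp [rgt, aug, List.getD_eq_getElem?_getD, h]

/-- The inner word of the window at `0` is a prefix. [folklore] -/
@[simp] theorem inner_zero (v : List Bool) (n : ℕ) : inner v n 0 = v.take n := rfl

/-- The quotient of the window at `0` is a suffix. [folklore] -/
@[simp] theorem quot_zero (v : List Bool) (n : ℕ) : quot v n 0 = v.drop n := by simp [quot]

/-- A window inside `v` has inner length `n`. [folklore] -/
theorem length_inner {v : List Bool} {n p : ℕ} (h : p + n ≤ v.length) : (inner v n p).length = n := by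
  simp [inner]; omega

/-- `(0; L 0 v; 1) = (0 L) (0; v; 1)`: shifting past a prefix ending in `0`. [folklore] -/
theorem aug_append_false_append (L v : List Bool) :
    aug ((L ++ [false]) ++ v) = (false :: L) ++ aug v := by
  simp [aug]

/-- Shifted windows have the same left endpoint … [folklore] -/
theorem lft_shift (L v : List Bool) (p : ℕ) :
    lft ((L ++ [false]) ++ v) (p + (L.length + 1)) = lft v p := by
  rw [lft, lft, aug_append_false_append, show p + (L.length + 1) = (false :: L).length + p by
    simp; omega, List.getD_append_right _ _ _ _ (Nat.le_add_right _ _), Nat.add_sub_cancel_left]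

/-- … the same right endpoint … [folklore] -/
theorem rgt_shift (L v : List Bool) (n p : ℕ) :
    rgt ((L ++ [false]) ++ v) n (p + (L.length + 1)) = rgt v n p := by
  rw [rgt, rgt, aug_append_false_append,
    show p + (L.length + 1) + n + 1 = (false :: L).length + (p + n + 1) by simp; omega,
    List.getD_append_right _ _ _ _ (Nat.le_add_right _ _), Nat.add_sub_cancel_left]

/-- … the same inner word … [folklore] -/
theorem inner_shift (L v : List Bool) (n p : ℕ) :
    inner ((L ++ [false]) ++ v) n (p + (L.length + 1)) = inner v n p := by
  rw [inner, inner, show p + (L.length + 1) = (L ++ [false]).length + p by simp; omega,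
    List.drop_append]
  simp [List.drop_eq_nil_of_le]

/-- … and the quotient shifted by the prefix. [folklore] -/
theorem quot_shift (L v : List Bool) (n p : ℕ) :
    quot ((L ++ [false]) ++ v) n (p + (L.length + 1)) = (L ++ [false]) ++ quot v n p := by
  rw [quot, quot, show p + (L.length + 1) = (L ++ [false]).length + p by simp; omega,
    List.take_append, show (L ++ [false]).length + p + n = (L ++ [false]).length + (p + n) by omega,
    List.drop_append]
  simp [List.drop_eq_nil_of_le, List.take_of_length_le]

/-! ### Motivic iterated integrals with general endpoints (properties I0, I1, I3) -/

section Im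

variable {H : Type} [AddCommGroup H] [Module ℚ H]

/-- Brown's `Iᵐ(a; u; b)` for all endpoints `a, b ∈ {0,1}` in terms of `J u = Iᵐ(0; u; 1)`, "uniquely
defined by the properties" **I0** (`Iᵐ(a; u; a) = 0` for `u ≠ ∅`), **I1** (`Iᵐ(a; ∅; b) = 1 = J ∅`)
and **I3** (reflection `Iᵐ(1; u; 0) = (-1)^{|u|} Iᵐ(0; ũ; 1)`). [cite: Brown2012, §2.4 I0, I1, I3] -/
def Im (J : List Bool → H) (a : Bool) (u : List Bool) (b : Bool) : H :=
  if u = [] then J [] else if a = b then 0 else if a = false then J u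
    else ((-1 : ℚ) ^ u.length) • J u.reverse

variable (J : List Bool → H)

/-- I1. [cite: Brown2012, §2.4 I1] -/
@[simp] theorem Im_nil (a b : Bool) : Im J a [] b = J [] := by simp [Im]

/-- I0. [cite: Brown2012, §2.4 I0] -/
theorem Im_self (a : Bool) {u : List Bool} (hu : u ≠ []) : Im J a u a = 0 := by simp [Im, hu]

/-- `Iᵐ(0; u; 1) = J u`. [cite: Brown2012, §2.2 (2.8)] -/
@[simp] theorem Im_false_true (u : List Bool) : Im J false u true = J u := by
  by_cases hu : u = [] <;> simp [Im, hu]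

/-- I3: `Iᵐ(1; u; 0) = (-1)^{|u|} Iᵐ(0; ũ; 1)`. [cite: Brown2012, §2.4 I3] -/
@[simp] theorem Im_true_false (u : List Bool) :
    Im J true u false = ((-1 : ℚ) ^ u.length) • J u.reverse := by
  by_cases hu : u = [] <;> simp [Im, hu]

end Im

/-! ### Brown's coaction data -/

/-- **The motivic input of §§3, 5, 6 of Brown's paper, abstractly.** A `ℚ`-vector space `H` (Brown's
`H`), the motivic iterated integrals `J u = Iᵐ(0; u; 1)` ((2.8); `ζᵐ(w) = J (ρ w)`), for each
`r ≥ 1` a linear functional `f r` — "the coefficient of `ζ_{2r+1} = π(ζᵐ(2r+1))`", i.e. a linear map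
`L_{2r+1} → ℚ` sending `ζ_{2r+1} ↦ 1` ((5.5)) composed with `π ∘ p_{2r+1}` — and the operator
`D r = ((ζ_{2r+1} ↦ 1) ⊗ id) ∘ D_{2r+1} : H → H` (Definitions 3.1 and 5.7), subject to:
* `coaction` — Goncharov's formula in Brown's infinitesimal form **(3.4)** for `D_{2r+1}` on
  `Iᵐ(0; v; 1)`, followed by `ζ_{2r+1} ↦ 1`: the sum over the windows (subsequences)
  `(a_p; a_{p+1} … a_{p+2r+1}; a_{p+2r+2})` of `(0; v; 1)` of `f r (Iᵐ(window)) • Iᵐ(quotient)`;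
* `f_levelOne` — **(3.12) with Theorem 4.3 (4.2)**: the coefficient of `ζ_{2r+1}` in
  `π(ζᵐ(2^{a} 3 2^{b}))` is `c_{2^a32^b} = zagierCoeff a b` (`r = a + b + 1`);
* `f_zetaOne` — **(3.11)–(3.12) with Lemma 3.8**: the coefficient of `ζ_{2r+1}` in
  `π(ζᵐ₁(2^{r}))`, `ζᵐ₁(2^{r}) = Iᵐ(0; 0(10)^r; 1)`, is `c_{12^r} = 2(-1)^r`;
* `J_rho_replicate_two_ne_zero` — **Lemma 3.4 / (3.6)**: `ζᵐ(2^{n}) ≠ 0`.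
These are exactly the motivic facts (Theorem 2.4 = [Goncharov 2005, Thm 1.2], Theorem 3.3,
Corollary 3.6, Theorem 4.3, Lemma 3.8, Lemma 3.4) that §§5–6 use; from them this file DERIVES the
level-lowering Lemma 5.5 and the matrix of Theorem 6.1, i.e. `Brown2012.LevelData`.
[cite: Brown2012, §3.1 (3.4), (3.11)–(3.12), Lemma 3.4, Lemma 3.8, Theorem 4.3] -/
structure CoactionData where
  /-- Brown's space `H` of motivic multiple zeta values. -/
  H : Type
  [instAddCommGroup : AddCommGroup H]
  [instModule : Module ℚ H]
  /-- `J u = Iᵐ(0; u; 1)`. -/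
  J : List Bool → H
  /-- The coefficient of `ζ_{2r+1}` ((5.5) after `π ∘ p_{2r+1}`). -/
  f : ℕ → H →ₗ[ℚ] ℚ
  /-- `D r = ((ζ_{2r+1} ↦ 1) ⊗ id) ∘ D_{2r+1}`. -/
  D : ℕ → H →ₗ[ℚ] H
  /-- (3.4), the infinitesimal coaction on `Iᵐ(0; v; 1)`, `ζ_{2r+1}`-component. -/
  coaction : ∀ r : ℕ, 1 ≤ r → ∀ v : List Bool,
    D r (J v) = ∑ p ∈ Finset.range (v.length + 1 - (2 * r + 1)),
      f r (Im J (lft v p) (inner v (2 * r + 1) p) (rgt v (2 * r + 1) p)) • J (quot v (2 * r + 1) p)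
  /-- (3.12) & (4.2): `π(ζᵐ(2^a 3 2^b)) = c_{2^a32^b} ζ_{2r+1}`, `c = zagierCoeff a b`. -/
  f_levelOne : ∀ a b : ℕ,
    f (a + b + 1) (J (rho (List.replicate a 2 ++ 3 :: List.replicate b 2))) = zagierCoeff a b
  /-- (3.11)–(3.12) & Lemma 3.8: `π(ζᵐ₁(2^r)) = c_{12^r} ζ_{2r+1}`, `c_{12^r} = 2(-1)^r`. -/
  f_zetaOne : ∀ r : ℕ, 1 ≤ r → f r (J (false :: rho (List.replicate r 2))) = 2 * (-1) ^ r
  /-- Lemma 3.4: `ζᵐ(2^n) ≠ 0`. -/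
  J_rho_replicate_two_ne_zero : ∀ n : ℕ, J (rho (List.replicate n 2)) ≠ 0

attribute [instance] CoactionData.instAddCommGroup CoactionData.instModule

namespace CoactionData

variable (C : CoactionData)

/-- `ζᵐ(w) = Iᵐ(0; ρ(w); 1)` (Brown's order of the arguments). [cite: Brown2012, Definition 5.2] -/
def z (w : List ℕ) : C.H := C.J (rho w)

/-- The term of the window at `p` in (3.4), with the quotient prefixed by `ρ(x)`. [cite: Brown2012, (3.4)] -/
def wterm (r : ℕ) (x : List ℕ) (v : List Bool) (p : ℕ) : C.H :=
  C.f r (Im C.J (lft v p) (inner v (2 * r + 1) p) (rgt v (2 * r + 1) p)) •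
    C.J (rho x ++ quot v (2 * r + 1) p)

/-- The left-hand side: (3.4) for `ζᵐ(w)` with quotients prefixed by `ρ(x)` (`x = ∅` gives
`D r (ζᵐ(w))`). [cite: Brown2012, (3.4)] -/
def lhs (r : ℕ) (x w : List ℕ) : C.H :=
  ∑ p ∈ Finset.range ((rho w).length + 1 - (2 * r + 1)), C.wterm r x (rho w) p

/-- (3.4) for `ζᵐ(w)`: `D r (ζᵐ(w))` is the left-hand side with `x = ∅`. [cite: Brown2012, (3.4)] -/
theorem D_z_eq_lhs {r : ℕ} (hr : 1 ≤ r) (w : List ℕ) : C.D r (C.z w) = C.lhs r [] w := by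
  rw [z, C.coaction r hr, lhs]
  simp [wterm]

end CoactionData

/-! ### The word-level description of the windows that contribute (proof of Theorem 6.1) -/

/-- The factor `v = w_{i+1} ⋯ w_{i+r}` of `r` letters at position `i`. [cite: Brown2012, Theorem 6.1] -/
def vK (w : List ℕ) (r i : ℕ) : List ℕ := (w.drop i).take r

/-- The quotient word `w` minus that factor. [cite: Brown2012, Theorem 6.1] -/
def qK (w : List ℕ) (r i : ℕ) : List ℕ := w.take i ++ w.drop (i + r)

/-- The quotient word of a type-(2) window: `x 3 2^r y ↦ x 2 y`, `x 2^r 3 y ↦ x 2 y`.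
[cite: Brown2012, proof of Theorem 6.1, case (2)] -/
def qT (w : List ℕ) (r i : ℕ) : List ℕ := w.take i ++ 2 :: w.drop (i + r + 1)

/-- Type (3): a level-one factor of `r` letters (weight `2r+1`) at position `i`.
[cite: Brown2012, proof of Theorem 6.1, case (3)] -/
def K1 (w : List ℕ) (r i : ℕ) : Prop := i + r ≤ w.length ∧ level (vK w r i) = 1

/-- Type (2), first kind: the factor `3 2^r` at position `i` (window `Iᵐ(0; 0(10)^r; 1) = ζᵐ₁(2^r)`).
[cite: Brown2012, proof of Theorem 6.1, case (2)] -/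
def T1 (w : List ℕ) (r i : ℕ) : Prop := (w.drop i).take (r + 1) = 3 :: List.replicate r 2

/-- Type (2), second kind: the factor `2^r 3` at position `i` (window `Iᵐ(1; (01)^r 0; 0) = -ζᵐ₁(2^r)`).
[cite: Brown2012, proof of Theorem 6.1, case (2)] -/
def T2 (w : List ℕ) (r i : ℕ) : Prop := (w.drop i).take (r + 1) = List.replicate r 2 ++ [3]

/-- `K1` is decidable. [folklore] -/
instance (w : List ℕ) (r i : ℕ) : Decidable (K1 w r i) := by unfold K1; infer_instance
/-- `T1` is decidable. [folklore] -/
instance (w : List ℕ) (r i : ℕ) : Decidable (T1 w r i) := by unfold T1; infer_instance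
/-- `T2` is decidable. [folklore] -/
instance (w : List ℕ) (r i : ℕ) : Decidable (T2 w r i) := by unfold T2; infer_instance

namespace CoactionData

variable (C : CoactionData)

/-- Contribution `c_v ζᵐ(x u y)` of the type-(3) window of the first kind at `i` (`w = u v y`).
[cite: Brown2012, proof of Theorem 6.1, case (3)] -/
def gK1 (r : ℕ) (x w : List ℕ) (i : ℕ) : C.H :=
  if K1 w r i then coeffOfLevelOne (vK w r i) • C.z (x ++ qK w r i) else 0

/-- Contribution `c_{ṽ} ζᵐ(x u y)` (with the sign `-`) of its right neighbour, the window of the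
second kind, present iff `y ≠ ∅`. [cite: Brown2012, proof of Theorem 6.1, case (3)] -/
def gK2 (r : ℕ) (x w : List ℕ) (i : ℕ) : C.H :=
  if K1 w r i ∧ i + r < w.length then coeffOfLevelOne (vK w r i).reverse • C.z (x ++ qK w r i) else 0

/-- Contribution `c_{12^r} ζᵐ(x u 2 y)` of a type-(2) window of the first kind.
[cite: Brown2012, proof of Theorem 6.1, case (2)] -/
def gT1 (r : ℕ) (x w : List ℕ) (i : ℕ) : C.H :=
  if T1 w r i then (2 * (-1 : ℚ) ^ r) • C.z (x ++ qT w r i) else 0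

/-- Contribution `c_{12^r} ζᵐ(x u 2 y)` (with the sign `-`) of a type-(2) window of the second kind.
[cite: Brown2012, proof of Theorem 6.1, case (2)] -/
def gT2 (r : ℕ) (x w : List ℕ) (i : ℕ) : C.H :=
  if T2 w r i then (2 * (-1 : ℚ) ^ r) • C.z (x ++ qT w r i) else 0

/-- The word-level right-hand side `M^f`-style: all contributing windows. [cite: Brown2012, (5.7)] -/
def rhs (r : ℕ) (x w : List ℕ) : C.H :=
  ∑ i ∈ Finset.range (w.length + 1), (C.gK1 r x w i - C.gK2 r x w i + C.gT1 r x w i - C.gT2 r x w i)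

/-- The span of the `ζᵐ(x u)` with `u` of level `≤ deg₃ w - 2` (and the right weight): the terms
neglected in `gr^F_{ℓ-1}` (proof of Lemma 5.6 / Theorem 6.1 (4)). [cite: Brown2012, Lemma 5.6] -/
def P (r : ℕ) (x w : List ℕ) : Submodule ℚ C.H :=
  Submodule.span ℚ {h | ∃ u, IsHoffman u ∧ weight u + (2 * r + 1) = weight w ∧
    level u + 2 ≤ level w ∧ h = C.z (x ++ u)}

/-- Generators of `P`. [folklore] -/
theorem z_mem_P {r : ℕ} {x w : List ℕ} {u : List ℕ} (hu : IsHoffman u)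
    (hwt : weight u + (2 * r + 1) = weight w) (hl : level u + 2 ≤ level w) :
    C.z (x ++ u) ∈ C.P r x w :=
  Submodule.subset_span ⟨u, hu, hwt, hl, rfl⟩

/-- `P` grows with the word. [folklore] -/
theorem P_append_le {r : ℕ} (x : List ℕ) {c : ℕ} {w : List ℕ} (hc : c = 2 ∨ c = 3) :
    C.P r (x ++ [c]) w ≤ C.P r x (c :: w) := by
  refine Submodule.span_le.2 ?_
  rintro _ ⟨u, hu, hwt, hl, rfl⟩
  rw [List.append_assoc, List.singleton_append]
  refine C.z_mem_P (fun i hi => ?_) ?_ ?_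
  · simp only [List.mem_cons] at hi
    rcases hi with rfl | hi
    · exact hc
    · exact hu i hi
  · rw [weight_cons, weight_cons, ← hwt]; ring
  · rcases hc with rfl | rfl
    · simpa using hl
    · simp only [level_cons_three]; omega

/-! ### Splitting off the first letter -/

/-- The right-hand side splits as the `i = 0` terms plus the shifted right-hand side. [folklore] -/
theorem rhs_cons (r : ℕ) (x : List ℕ) (c : ℕ) (w : List ℕ) :
    C.rhs r x (c :: w) = (C.gK1 r x (c :: w) 0 - C.gK2 r x (c :: w) 0 + C.gT1 r x (c :: w) 0 -
      C.gT2 r x (c :: w) 0) + C.rhs r (x ++ [c]) w := by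
  rw [rhs, rhs, List.length_cons, Finset.sum_range_succ', add_comm]
  congr 1
  refine Finset.sum_congr rfl fun i _ => ?_
  have hK : K1 (c :: w) r (i + 1) ↔ K1 w r i := by
    simp only [K1, vK, List.length_cons, List.drop_succ_cons]; omega
  have hq : x ++ qK (c :: w) r (i + 1) = (x ++ [c]) ++ qK w r i := by
    simp [qK, Nat.add_right_comm i 1 r]
  have hT1 : T1 (c :: w) r (i + 1) ↔ T1 w r i := by simp [T1]
  have hT2 : T2 (c :: w) r (i + 1) ↔ T2 w r i := by simp [T2]
  have hqT : x ++ qT (c :: w) r (i + 1) = (x ++ [c]) ++ qT w r i := by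
    simp [qT, show i + 1 + r + 1 = (i + r + 1) + 1 by omega]
  have hv : vK (c :: w) r (i + 1) = vK w r i := rfl
  simp only [gK1, gK2, gT1, gT2, hK, hq, hT1, hT2, hqT, hv, List.length_cons,
    show i + 1 + r < w.length + 1 ↔ i + r < w.length by omega]

/-- The left-hand side splits as the windows at `p < |ρ(c)|` plus the shifted left-hand side. [folklore] -/
theorem lhs_cons {r : ℕ} (x : List ℕ) {c : ℕ} (hc : 2 ≤ c) (w : List ℕ) :
    C.lhs r x (c :: w) =
      ∑ p ∈ Finset.range (min ((rho (c :: w)).length + 1 - (2 * r + 1)) c), C.wterm r x (rho (c :: w)) p +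
        C.lhs r (x ++ [c]) w := by
  set n := 2 * r + 1 with hn
  set M := (rho (c :: w)).length + 1 - n with hM
  set L := (rho w).length + 1 - n with hL
  have hlen : (rho (c :: w)).length = c + (rho w).length := by
    rw [rho_cons, List.length_append, length_rhoLetter (by omega)]
  have hML : M = min M c + L := by
    simp only [hM, hL, hlen]; omega
  rw [lhs, lhs, ← hM, ← hL]
  conv_lhs => rw [hML, Finset.sum_range_add]
  congr 1
  refine Finset.sum_congr rfl fun i hi => ?_
  have hi' : i < L := Finset.mem_range.1 hi
  have hmin : min M c = c := by simp only [hM, hL, hlen] at hi' ⊢; omega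
  rw [hmin]
  -- the shift
  obtain ⟨L', hL'c, hρL⟩ : ∃ L' : List Bool, c = L'.length + 1 ∧ rhoLetter c = L' ++ [false] :=
    ⟨true :: List.replicate (c - 2) false, by simp; omega, rhoLetter_eq_append_false hc⟩
  rw [wterm, wterm, rho_cons, hρL, show c + i = i + (L'.length + 1) by omega, lft_shift, rgt_shift,
    inner_shift, quot_shift, rho_append, rho_cons, rho_nil, List.append_nil, hρL]
  simp only [List.append_assoc]

end CoactionData



/-! ### Word arithmetic: weights and levels of prefixes -/

/-- A prefix of a Hoffman word is Hoffman. [folklore] -/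
theorem _root_.Literature.NumberTheory.Transcendental.MZV.IsHoffman.take {w : List ℕ} (hw : IsHoffman w) (k : ℕ) : IsHoffman (w.take k) :=
  fun i hi => hw i (List.mem_of_mem_take hi)

/-- A suffix of a Hoffman word is Hoffman. [folklore] -/
theorem _root_.Literature.NumberTheory.Transcendental.MZV.IsHoffman.drop {w : List ℕ} (hw : IsHoffman w) (k : ℕ) : IsHoffman (w.drop k) :=
  fun i hi => hw i (List.mem_of_mem_drop hi)

/-- The reverse of a Hoffman word is Hoffman. [folklore] -/
theorem _root_.Literature.NumberTheory.Transcendental.MZV.IsHoffman.reverse {w : List ℕ} (hw : IsHoffman w) : IsHoffman w.reverse :=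
  fun i hi => hw i (List.mem_reverse.1 hi)

/-- `deg₃` is invariant under reversal. [folklore] -/
@[simp] theorem level_reverse (w : List ℕ) : level w.reverse = level w := by simp [level]

/-- The weight is invariant under reversal. [folklore] -/
theorem weight_reverse (w : List ℕ) : weight w.reverse = weight w := by simp [weight, List.sum_reverse]

/-- `|w| = 2·len(w) + deg₃ w` for a Hoffman word. [folklore] -/
theorem weight_eq_two_mul_length_add_level {w : List ℕ} (hw : IsHoffman w) :
    weight w = 2 * w.length + level w := by
  induction w with
  | nil => simp [weight, level]
  | cons a w ih =>
    have hw' : IsHoffman w := fun i hi => hw i (by simp [hi])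
    rcases hw a (by simp) with rfl | rfl
    · rw [weight_cons, level_cons_two, ih hw', List.length_cons]; ring
    · rw [weight_cons, level_cons_three, ih hw', List.length_cons]; ring

/-- `|w| = |w↾k| + |w⇂k|`. [folklore] -/
theorem weight_take_add_weight_drop (w : List ℕ) (k : ℕ) :
    weight (w.take k) + weight (w.drop k) = weight w := by
  rw [weight, weight, weight, ← List.sum_append, List.take_append_drop]

/-- `deg₃ w = deg₃ (w↾k) + deg₃ (w⇂k)`. [folklore] -/
theorem level_take_add_level_drop (w : List ℕ) (k : ℕ) :
    level (w.take k) + level (w.drop k) = level w := by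
  rw [← level_append, List.take_append_drop]

/-- Prefix weights are monotone. [folklore] -/
theorem weight_take_mono (w : List ℕ) {i k : ℕ} (h : i ≤ k) : weight (w.take i) ≤ weight (w.take k) := by
  have : (w.take k).take i = w.take i := by rw [List.take_take, min_eq_left h]
  rw [← this, ← weight_take_add_weight_drop (w.take k) i]
  exact Nat.le_add_right _ _

/-- `|w↾(k+1)| = |w↾k| + w_k`. [folklore] -/
theorem weight_take_succ {w : List ℕ} {k : ℕ} (hk : k < w.length) :
    weight (w.take (k + 1)) = weight (w.take k) + w[k] := by
  rw [List.take_succ_eq_append_getElem hk, weight, List.sum_append, List.sum_singleton]; rfl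

/-- No prefix ends strictly inside a block. [folklore] -/
theorem weight_take_ne {w : List ℕ} {k j : ℕ} (hk : k < w.length) (hj0 : 0 < j) (hj : j < w[k])
    (i : ℕ) : weight (w.take i) ≠ weight (w.take k) + j := by
  intro h
  rcases le_or_gt i k with hik | hik
  · have := weight_take_mono w hik; omega
  · have h1 := weight_take_mono w (show k + 1 ≤ i by omega)
    rw [weight_take_succ hk] at h1
    omega

/-- A level-one Hoffman word is `2^a 3 2^b`. [folklore] -/
theorem eq_twos_three_twos_of_level_eq_one {v : List ℕ} (hv : IsHoffman v) (h1 : level v = 1) :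
    ∃ a b, v = List.replicate a 2 ++ 3 :: List.replicate b 2 ∧ a + b + 1 = v.length := by
  obtain ⟨u, b, hu, rfl⟩ := exists_eq_append_three_twos hv (by omega)
  have hl : level u = 0 := by simp at h1; omega
  refine ⟨u.length, b, ?_, by simp; omega⟩
  rw [← eq_replicate_two_of_level_eq_zero hu hl]

/-- A sum over `range (min m 2)`. [folklore] -/
theorem sum_range_min_two {M : Type*} [AddCommMonoid M] (m : ℕ) (g : ℕ → M) :
    ∑ p ∈ Finset.range (min m 2), g p = (if 0 < m then g 0 else 0) + (if 1 < m then g 1 else 0) := by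
  rcases m with _ | _ | m
  · simp
  · simp
  · rw [show min (m + 2) 2 = 2 by omega]
    simp [Finset.sum_range_succ, show 1 < m + 2 by omega]

/-- A sum over `range (min m 3)`. [folklore] -/
theorem sum_range_min_three {M : Type*} [AddCommMonoid M] (m : ℕ) (g : ℕ → M) :
    ∑ p ∈ Finset.range (min m 3), g p =
      (if 0 < m then g 0 else 0) + (if 1 < m then g 1 else 0) + (if 2 < m then g 2 else 0) := by
  rcases m with _ | _ | _ | m
  · simp
  · simp
  · simp [Finset.sum_range_succ]
  · rw [show min (m + 3) 3 = 3 by omega]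
    simp [Finset.sum_range_succ, show 1 < m + 3 by omega, show 2 < m + 3 by omega, add_assoc]

namespace CoactionData

variable (C : CoactionData)

/-- (3.12) & (4.2) for a level-one word `v` of `r` letters: `f r (ζᵐ(v)) = c_v`.
[cite: Brown2012, (3.12) and Theorem 4.3 (4.2)] -/
theorem f_J_rho_of_level_one {v : List ℕ} (hv : IsHoffman v) (h1 : level v = 1) {r : ℕ}
    (hr : v.length = r) : C.f r (C.J (rho v)) = coeffOfLevelOne v := by
  obtain ⟨a, b, rfl, hab⟩ := eq_twos_three_twos_of_level_eq_one hv h1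
  rw [coeffOfLevelOne_eq, ← C.f_levelOne a b, hab, hr]

/-! ### The window at `p = 0` (type (3), first kind, or nothing) -/

/-- The window `(0; a₁ ⋯ a_n; a_{n+1})`: it is `ζᵐ(v)` for the prefix `v` of `w` of weight `n` when
`a_{n+1} = 1`, contributing `c_v ζᵐ(x u)` if `deg₃ v = 1` and a lower-level term if `deg₃ v ≥ 2`, and
it vanishes by I0 when `a_{n+1} = 0`. [cite: Brown2012, proof of Theorem 6.1] -/
theorem wterm_zero_sub_gK1_mem {w : List ℕ} (hw : IsHoffman w) {r : ℕ} (hr : 1 ≤ r) (x : List ℕ) :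
    (if 0 < (rho w).length + 1 - (2 * r + 1) then C.wterm r x (rho w) 0 else 0) - C.gK1 r x w 0 ∈
      C.P r x w := by
  set n := 2 * r + 1 with hn
  have hlen := length_rho hw
  -- `gK1 ≠ 0` forces the prefix `w↾r` to have weight `n`
  have hK1wt : K1 w r 0 → weight (w.take r) = n ∧ r ≤ w.length := by
    rintro ⟨hrle, hl1⟩
    simp only [vK, List.drop_zero, Nat.zero_add] at hrle hl1
    have := weight_eq_two_mul_length_add_level (hw.take r)
    rw [hl1, List.length_take, min_eq_left hrle] at this
    exact ⟨by omega, hrle⟩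
  by_cases hle : n ≤ (rho w).length
  · rw [if_pos (by omega)]
    obtain ⟨k, j, hk, hkj, hj1, hj2⟩ := exists_block hw (m := n) (by rw [← hlen]; exact hle)
    rcases Nat.eq_zero_or_pos j with rfl | hjpos
    · -- `n` is a block boundary: the window is `ζᵐ(w↾k)`
      rw [Nat.add_zero] at hkj
      have hv : IsHoffman (w.take k) := hw.take k
      have hinner : inner (rho w) n 0 = rho (w.take k) := by
        rw [inner_zero, ← hkj, take_rho_weight_take hw]
      have hquot : quot (rho w) n 0 = rho (w.drop k) := by
        rw [quot_zero, ← hkj, drop_rho_weight_take hw]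
      have hrgt : rgt (rho w) n 0 = true := by
        rcases lt_or_eq_of_le hk with hk' | rfl
        · have h2 : 2 ≤ w[k] := two_le_of_isHoffman hw (List.getElem_mem hk')
          have hnlt : n < (rho w).length := by
            rw [hlen, ← hkj, ← weight_take_add_weight_drop w (k + 1), weight_take_succ hk']; omega
          rw [rgt_of_lt (by simpa using hnlt)]
          have := getElem?_rho_weight_take_add hw hk' (j := 0) (by omega)
          rw [Nat.add_zero, hkj, List.getElem?_eq_getElem hnlt] at this
          simpa using this
        · exact rgt_of_eq (by rw [Nat.zero_add, hlen, ← hkj, List.take_length])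
      have hwterm : C.wterm r x (rho w) 0 = C.f r (C.J (rho (w.take k))) • C.z (x ++ w.drop k) := by
        rw [wterm, ← hn, lft_zero, hinner, hrgt, Im_false_true, hquot, z, rho_append]
      by_cases h1 : level (w.take k) = 1
      · -- type (3): `k = r`, the term is `gK1`
        have hkr : k = r := by
          have := weight_eq_two_mul_length_add_level hv
          rw [hkj, h1, List.length_take, min_eq_left hk] at this
          omega
        subst hkr
        have hK : K1 w k 0 := ⟨by simpa using hk, by simpa [vK] using h1⟩
        have hg : C.gK1 k x w 0 = coeffOfLevelOne (w.take k) • C.z (x ++ w.drop k) := by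
          rw [gK1, if_pos hK]; simp [vK, qK]
        rw [hwterm, hg, C.f_J_rho_of_level_one hv h1 (by rw [List.length_take, min_eq_left hk]),
          sub_self]
        exact Submodule.zero_mem _
      · -- level `≥ 2`: a neglected term; and `gK1 = 0`
        have h2 : 2 ≤ level (w.take k) := by
          have hpar := weight_eq_two_mul_length_add_level hv
          rw [hkj] at hpar
          rcases Nat.lt_or_ge (level (w.take k)) 2 with hlt | hge
          · interval_cases h : level (w.take k)
            · omega
            · exact absurd rfl h1
          · exact hge
        have hg : C.gK1 r x w 0 = 0 := by
          rw [gK1, if_neg]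
          intro hK
          obtain ⟨hwr, hrle⟩ := hK1wt hK
          have := take_inj_of_weight_eq hw hrle hk (hwr.trans hkj.symm)
          subst this
          simp only [K1, vK, List.drop_zero] at hK
          exact h1 hK.2
        rw [hwterm, hg, sub_zero]
        refine Submodule.smul_mem _ _ (C.z_mem_P (hw.drop k) ?_ ?_)
        · have := weight_take_add_weight_drop w k; omega
        · have := level_take_add_level_drop w k; omega
    · -- `n` strictly inside a block: `a_{n+1} = 0 = a_0`, the window vanishes by I0
      have hklt : k < w.length := lt_of_le_of_ne hk fun h => by have := hj2 h; omega
      have hjlt : j < w[k] := hj1 hklt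
      have hnlt : n < (rho w).length := by
        rw [hlen, ← hkj, ← weight_take_add_weight_drop w (k + 1), weight_take_succ hklt]; omega
      have hrgt : rgt (rho w) n 0 = false := by
        rw [rgt_of_lt (by simpa using hnlt)]
        have := getElem?_rho_weight_take_add hw hklt hjlt
        rw [hkj, List.getElem?_eq_getElem hnlt] at this
        simp only [Option.some.injEq, Nat.zero_add] at this ⊢
        rw [this]
        simp [hjpos.ne']
      have hwterm : C.wterm r x (rho w) 0 = 0 := by
        rw [wterm, ← hn, lft_zero, hrgt, Im_self _ _ (by
          rw [← List.length_pos_iff, length_inner (by simpa using hle)]; omega), map_zero, zero_smul]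
      have hg : C.gK1 r x w 0 = 0 := by
        rw [gK1, if_neg]
        intro hK
        exact weight_take_ne hklt hjpos hjlt r ((hK1wt hK).1.trans hkj.symm)
      rw [hwterm, hg, sub_zero]
      exact Submodule.zero_mem _
  · rw [if_neg (by omega)]
    have hg : C.gK1 r x w 0 = 0 := by
      rw [gK1, if_neg]
      intro hK
      have h1 := (hK1wt hK).1
      have h2 := weight_take_add_weight_drop w r
      omega
    rw [hg, sub_zero]
    exact Submodule.zero_mem _


/-! ### The window at `p = 1` (second kinds of types (2) and (3), or nothing) -/

/-- `ρ(w)` around the block of the `k`-th letter. [folklore] -/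
theorem rho_eq_take_letter_drop {w : List ℕ} {k : ℕ} (hk : k < w.length) :
    rho w = rho (w.take k) ++ (rhoLetter w[k] ++ rho (w.drop (k + 1))) := by
  rw [← rho_cons, ← rho_append]
  congr 1
  simp

/-- `a₁ = 1` (the first letter of `ρ(w)`). [folklore] -/
theorem lft_one {w : List ℕ} (hw : w ≠ []) : lft (rho w) 1 = true := by
  obtain ⟨a, w, rfl⟩ := List.exists_cons_of_ne_nil hw
  rw [show (1 : ℕ) = 0 + 1 from rfl, lft_succ (by simp [rhoLetter])]
  simp [rhoLetter]

/-- The window `(a₁; a₂ ⋯ a_{n+1}; a_{n+2})` when `n = |w↾k|` is a block boundary inside `w`: it is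
`Iᵐ(1; σ 1; 0) = -ζᵐ(ṽ)` (`ρ(v) = 1σ`, `v = w↾k`, by I3), with quotient `ζᵐ(x u)`, `w = v u`.
[cite: Brown2012, proof of Theorem 6.1, case (3)] -/
theorem wterm_one_of_boundary {w : List ℕ} (hw : IsHoffman w) {k r : ℕ} (hk : k < w.length)
    (hkn : weight (w.take k) = 2 * r + 1) (x : List ℕ) :
    1 < (rho w).length + 1 - (2 * r + 1) ∧
      C.wterm r x (rho w) 1 = -(C.f r (C.J (rho (w.take k).reverse)) • C.z (x ++ w.drop k)) := by
  set n := 2 * r + 1 with hn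
  have hlen := length_rho hw
  have hv : IsHoffman (w.take k) := hw.take k
  have h2 : 2 ≤ w[k] := two_le_of_isHoffman hw (List.getElem_mem hk)
  have hwt : weight w = n + w[k] + weight (w.drop (k + 1)) := by
    rw [← weight_take_add_weight_drop w (k + 1), weight_take_succ hk, hkn]
  have hne : w.take k ≠ [] := by
    intro h
    rw [h] at hkn
    simp [weight] at hkn
  have hne' : w.drop k ≠ [] := by simp; omega
  obtain ⟨t, ht⟩ := rho_eq_true_cons hne
  obtain ⟨t', ht'⟩ := rho_eq_true_cons hne'
  have htl : t.length = n - 1 := by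
    have := length_rho hv
    rw [ht, hkn, List.length_cons] at this
    omega
  have hρ : rho w = true :: t ++ true :: t' := by
    rw [← ht, ← ht', ← rho_append, List.take_append_drop]
  refine ⟨by rw [hlen]; omega, ?_⟩
  have hlft : lft (rho w) 1 = true := lft_one (by rintro rfl; simp at hk)
  have hrgt : rgt (rho w) n 1 = false := by
    rw [rgt_of_lt (by rw [hlen]; omega)]
    have := getElem?_rho_weight_take_add hw hk (j := 1) (by omega)
    rw [hkn, show n + 1 = 1 + n by omega, List.getElem?_eq_getElem (by rw [hlen]; omega)] at this
    simp only [Option.some.injEq] at this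
    rw [this]
    simp
  have hinner : inner (rho w) n 1 = t ++ [true] := by
    rw [inner, hρ, List.cons_append, List.drop_succ_cons, List.drop_zero, List.take_append,
      List.take_of_length_le (by omega), htl, show n - (n - 1) = 1 by omega]
    simp
  have hquot : quot (rho w) n 1 = rho (w.drop k) := by
    rw [quot, hρ, ht', show 1 + n = (true :: t).length + 1 by simp [htl]; omega, List.drop_append,
      List.take_append_of_le_length (by simp)]
    simp
  have hrev : rho (w.take k).reverse = true :: t.reverse := by
    rw [rho_reverse hne, ht, List.tail_cons]
  rw [wterm, ← hn, hlft, hrgt, hinner, Im_true_false, hquot, z, rho_append, hrev, map_smul,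
    List.length_append, List.length_singleton, htl, show n - 1 + 1 = n by omega,
    show ((-1 : ℚ) ^ n) = -1 from Odd.neg_one_pow ⟨r, by omega⟩, List.reverse_append,
    List.reverse_singleton, List.singleton_append, smul_eq_mul, neg_one_mul, neg_smul]

/-- The window `(a₁; a₂ ⋯ a_{n+1}; a_{n+2})` when `n - 1 = |w↾k|` is a block boundary followed by the
letter `3`: it is `Iᵐ(1; σ 1 0; 0) = -Iᵐ(0; 0 1 σ̃; 1)` (by I3) with quotient `ζᵐ(x 2 y)`,
`w = v 3 y`. [cite: Brown2012, proof of Theorem 6.1, case (2)] -/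
theorem wterm_one_of_boundary_three {w : List ℕ} (hw : IsHoffman w) {k r : ℕ} (hk : k < w.length)
    (hkn : weight (w.take k) + 1 = 2 * r + 1) (h3 : w[k] = 3) (hr : 1 ≤ r) (x : List ℕ) :
    1 < (rho w).length + 1 - (2 * r + 1) ∧
      C.wterm r x (rho w) 1 =
        -(C.f r (C.J (false :: rho (w.take k).reverse)) • C.z (x ++ 2 :: w.drop (k + 1))) := by
  set n := 2 * r + 1 with hn
  have hlen := length_rho hw
  have hv : IsHoffman (w.take k) := hw.take k
  have hwt : weight w = n + 2 + weight (w.drop (k + 1)) := by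
    rw [← weight_take_add_weight_drop w (k + 1), weight_take_succ hk, h3]; omega
  have hne : w.take k ≠ [] := by
    intro h
    rw [h] at hkn
    simp [weight] at hkn
    omega
  obtain ⟨t, ht⟩ := rho_eq_true_cons hne
  have htl : t.length = n - 2 := by
    have := length_rho hv
    rw [ht, List.length_cons] at this
    omega
  have hρ : rho w = true :: t ++ (true :: false :: false :: rho (w.drop (k + 1))) := by
    rw [rho_eq_take_letter_drop hk, ht, h3]
    rfl
  refine ⟨by rw [hlen]; omega, ?_⟩
  have hlft : lft (rho w) 1 = true := lft_one (by rintro rfl; simp at hk)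
  have hrgt : rgt (rho w) n 1 = false := by
    rw [rgt_of_lt (by rw [hlen]; omega)]
    have := getElem?_rho_weight_take_add hw hk (j := 2) (by omega)
    rw [show weight (w.take k) + 2 = 1 + n by omega,
      List.getElem?_eq_getElem (by rw [hlen]; omega)] at this
    simp only [Option.some.injEq] at this
    rw [this]
    simp
  have hinner : inner (rho w) n 1 = t ++ [true, false] := by
    rw [inner, hρ, List.cons_append, List.drop_succ_cons, List.drop_zero, List.take_append,
      List.take_of_length_le (by omega), htl, show n - (n - 2) = 2 by omega]
    simp
  have hquot : quot (rho w) n 1 = rho (2 :: w.drop (k + 1)) := by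
    rw [quot, hρ, show 1 + n = (true :: t).length + 2 by simp [htl]; omega, List.drop_append,
      List.take_append_of_le_length (by simp)]
    simp [rhoLetter]
  have hrev : rho (w.take k).reverse = true :: t.reverse := by
    rw [rho_reverse hne, ht, List.tail_cons]
  rw [wterm, ← hn, hlft, hrgt, hinner, Im_true_false, hquot, z, rho_append, hrev, map_smul,
    List.length_append, htl, show n - 2 + [true, false].length = n by simp; omega,
    show ((-1 : ℚ) ^ n) = -1 from Odd.neg_one_pow ⟨r, by omega⟩, List.reverse_append]
  simp [neg_smul]

/-- **The window at `p = 1`.** It is the right neighbour `-c_{ṽ} ζᵐ(x u)` of the type-(3) window at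
`p = 0` when `w = v u` with `deg₃ v = 1`, `|v| = 2r+1`, `u ≠ ∅`; it is `-c_{12^r} ζᵐ(x 2 y)` when
`w = 2^r 3 y` (type (2)); otherwise it vanishes (I0) or is a neglected lower-level term.
[cite: Brown2012, proof of Theorem 6.1, cases (2), (3)] -/
theorem wterm_one_add_mem {w : List ℕ} (hw : IsHoffman w) {r : ℕ} (hr : 1 ≤ r) (x : List ℕ) :
    (if 1 < (rho w).length + 1 - (2 * r + 1) then C.wterm r x (rho w) 1 else 0) + C.gK2 r x w 0 +
      C.gT2 r x w 0 ∈ C.P r x w := by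
  set n := 2 * r + 1 with hn
  have hlen := length_rho hw
  by_cases hA : K1 w r 0 ∧ 0 + r < w.length
  · -- type (3), second kind, neighbour of the window at `0`
    obtain ⟨⟨hrle, hl1⟩, hrlt⟩ := hA
    simp only [vK, List.drop_zero, Nat.zero_add] at hrle hl1 hrlt
    have hwt : weight (w.take r) = n := by
      have := weight_eq_two_mul_length_add_level (hw.take r)
      rw [hl1, List.length_take, min_eq_left hrle] at this
      omega
    obtain ⟨hwin, hwterm⟩ := C.wterm_one_of_boundary hw hrlt hwt x
    rw [if_pos hwin, hwterm]
    have hg2 : C.gK2 r x w 0 = coeffOfLevelOne (w.take r).reverse • C.z (x ++ w.drop r) := by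
      rw [gK2, if_pos ⟨⟨by simpa using hrle, by simpa [vK] using hl1⟩, by simpa using hrlt⟩]
      simp [vK, qK]
    have hgT : C.gT2 r x w 0 = 0 := by
      rw [gT2, if_neg]
      intro hT
      have h := congrArg (List.take r) hT
      rw [List.drop_zero, List.take_take, min_eq_left (Nat.le_succ r), List.take_left' (by simp)] at h
      rw [h, level_replicate_two] at hl1
      exact absurd hl1 (by norm_num)
    rw [hg2, hgT, add_zero, C.f_J_rho_of_level_one (hw.take r).reverse (by simpa using hl1)
      (by rw [List.length_reverse, List.length_take, min_eq_left hrle]), neg_add_cancel]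
    exact Submodule.zero_mem _
  · by_cases hB : T2 w r 0
    · -- type (2), second kind: `w = 2^r 3 y`
      have hT : w.take (r + 1) = List.replicate r 2 ++ [3] := by simpa [T2] using hB
      have hrlt : r < w.length := by
        have := congrArg List.length hT
        simp at this
        omega
      have htake : w.take r = List.replicate r 2 := by
        have h := congrArg (List.take r) hT
        rwa [List.take_take, min_eq_left (Nat.le_succ r), List.take_left' (by simp)] at h
      have h3 : w[r] = 3 := by
        have h := List.getElem_take' (xs := w) (i := r) (j := r + 1) (hi := hrlt) (hj := Nat.lt_succ_self r)
        rw [h]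
        simp [hT]
      have hwt : weight (w.take r) + 1 = n := by
        rw [htake]
        simp [weight]
        omega
      obtain ⟨hwin, hwterm⟩ := C.wterm_one_of_boundary_three hw hrlt hwt h3 hr x
      rw [if_pos hwin, hwterm]
      have hg2 : C.gK2 r x w 0 = 0 := by
        rw [gK2, if_neg]
        rintro ⟨⟨-, hl1⟩, -⟩
        simp [vK, htake] at hl1
      have hgT : C.gT2 r x w 0 = (2 * (-1 : ℚ) ^ r) • C.z (x ++ 2 :: w.drop (r + 1)) := by
        rw [gT2, if_pos hB]
        simp [qT]
      rw [hg2, hgT, add_zero, htake, List.reverse_replicate, C.f_zetaOne r hr, neg_add_cancel]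
      exact Submodule.zero_mem _
    · -- nothing, or a neglected term
      have hg2 : C.gK2 r x w 0 = 0 := by rw [gK2, if_neg hA]
      have hgT : C.gT2 r x w 0 = 0 := by rw [gT2, if_neg hB]
      rw [hg2, hgT, add_zero, add_zero]
      by_cases hwin : 1 < (rho w).length + 1 - n
      · rw [if_pos hwin]
        have hwne : w ≠ [] := by
          rintro rfl
          rw [rho_nil, List.length_nil] at hwin
          omega
        have hlft : lft (rho w) 1 = true := lft_one hwne
        have hin : inner (rho w) n 1 ≠ [] := by
          rw [← List.length_pos_iff, length_inner (by omega)]; omega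
        rcases Nat.lt_or_ge (n + 1) (rho w).length with hlt | hge
        · obtain ⟨k, j, hk, hkj, hj1, hj2⟩ := exists_block hw (m := n + 1) (by rw [← hlen]; omega)
          have hklt : k < w.length := lt_of_le_of_ne hk fun h => by
            have := hj2 h
            subst h
            rw [List.take_length] at hkj
            omega
          have hjlt := hj1 hklt
          have hwk : w[k] ≤ 3 := by rcases hw _ (List.getElem_mem hklt) with h | h <;> omega
          have hget := getElem?_rho_weight_take_add hw hklt hjlt
          rw [hkj, show n + 1 = 1 + n by omega, List.getElem?_eq_getElem (by omega)] at hget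
          simp only [Option.some.injEq] at hget
          rcases j with _ | _ | _ | j
          · -- `a_{n+2} = 1 = a_1`: vanishes
            have hrgt : rgt (rho w) n 1 = true := by
              rw [rgt_of_lt (by omega), hget]; simp
            rw [wterm, ← hn, hlft, hrgt, Im_self _ _ hin, map_zero, zero_smul]
            exact Submodule.zero_mem _
          · -- boundary at `n`, `deg₃ (w↾k) ≥ 2`
            have hkn : weight (w.take k) = n := by omega
            have hpar := weight_eq_two_mul_length_add_level (hw.take k)
            rw [hkn, List.length_take, min_eq_left hk] at hpar
            have hne1 : level (w.take k) ≠ 1 := by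
              intro h1
              apply hA
              have hkr : k = r := by omega
              subst hkr
              exact ⟨⟨by simpa using hk, by simpa [vK] using h1⟩, by simpa using hklt⟩
            have h2 : 2 ≤ level (w.take k) := by omega
            obtain ⟨-, hwterm⟩ := C.wterm_one_of_boundary hw hklt hkn x
            rw [hwterm]
            refine Submodule.neg_mem _ (Submodule.smul_mem _ _ (C.z_mem_P (hw.drop k) ?_ ?_))
            · have := weight_take_add_weight_drop w k; omega
            · have := level_take_add_level_drop w k; omega
          · -- boundary at `n - 1` followed by `3`, `deg₃ (w↾k) ≥ 2`
            have h3 : w[k] = 3 := by omega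
            have hkn : weight (w.take k) + 1 = n := by omega
            have hpar := weight_eq_two_mul_length_add_level (hw.take k)
            rw [List.length_take, min_eq_left hk] at hpar
            have hne0 : level (w.take k) ≠ 0 := by
              intro h0
              apply hB
              have hkr : k = r := by omega
              subst hkr
              have htk := eq_replicate_two_of_level_eq_zero (hw.take k) h0
              rw [List.length_take, min_eq_left hk] at htk
              show (w.drop 0).take (k + 1) = _
              rw [List.drop_zero, List.take_succ_eq_append_getElem hklt, htk, h3]
            have h2 : 2 ≤ level (w.take k) := by omega
            obtain ⟨-, hwterm⟩ := C.wterm_one_of_boundary_three hw hklt hkn h3 hr x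
            rw [hwterm]
            refine Submodule.neg_mem _ (Submodule.smul_mem _ _ (C.z_mem_P (u := 2 :: w.drop (k + 1))
              (fun i hi => ?_) ?_ ?_))
            · simp only [List.mem_cons] at hi
              rcases hi with rfl | hi
              · exact Or.inl rfl
              · exact hw.drop (k + 1) i hi
            · have := weight_take_add_weight_drop w (k + 1)
              rw [weight_take_succ hklt, h3] at this
              rw [weight_cons]
              omega
            · have := level_take_add_level_drop w (k + 1)
              rw [List.take_succ_eq_append_getElem hklt, h3, level_append, level_cons_three] at this
              simp only [level_cons_two]
              have h0 : level ([] : List ℕ) = 0 := rfl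
              omega
          · omega
        · -- `a_{n+2}` is the final `1`: vanishes
          have hrgt : rgt (rho w) n 1 = true := rgt_of_eq (by omega)
          rw [wterm, ← hn, hlft, hrgt, Im_self _ _ hin, map_zero, zero_smul]
          exact Submodule.zero_mem _
      · rw [if_neg hwin]
        exact Submodule.zero_mem _

/-! ### The window at `p = 2` for a word starting with `3` (type (2), first kind, or nothing) -/

/-- **The window at `p = 2` of `(0; 100 ρ(w'); 1)`.** It is `Iᵐ(0; 0 ρ(2^r); 1) = ζᵐ₁(2^r)`,
contributing `c_{12^r} ζᵐ(x 2 y)`, when `w' = 2^r y`; otherwise it vanishes or is neglected.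
[cite: Brown2012, proof of Theorem 6.1, case (2)] -/
theorem wterm_two_sub_gT1_mem {w : List ℕ} (hw : IsHoffman (3 :: w)) {r : ℕ} (hr : 1 ≤ r)
    (x : List ℕ) :
    (if 2 < (rho (3 :: w)).length + 1 - (2 * r + 1) then C.wterm r x (rho (3 :: w)) 2 else 0) -
      C.gT1 r x (3 :: w) 0 ∈ C.P r x (3 :: w) := by
  set n := 2 * r + 1 with hn
  have hw' : IsHoffman w := fun i hi => hw i (by simp [hi])
  have hlen := length_rho hw'
  have hρ : rho (3 :: w) = [true, false, false] ++ rho w := rfl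
  have hlen3 : (rho (3 :: w)).length = weight w + 3 := by rw [hρ, List.length_append, hlen]; simp; omega
  -- `gT1 ≠ 0` means `w↾r = 2^r`
  have hT1 : T1 (3 :: w) r 0 ↔ r ≤ w.length ∧ w.take r = List.replicate r 2 := by
    simp only [T1, List.drop_zero, List.take_succ_cons, List.cons.injEq, true_and]
    constructor
    · intro h
      have := congrArg List.length h
      simp at this
      exact ⟨by omega, h⟩
    · exact fun h => h.2
  by_cases hwin : 2 < (rho (3 :: w)).length + 1 - n
  · rw [if_pos hwin]
    have h2r : 2 * r ≤ weight w := by rw [hlen3] at hwin; omega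
    obtain ⟨k, j, hk, hkj, hj1, hj2⟩ := exists_block hw' h2r
    have hlft : lft (rho (3 :: w)) 2 = false := by
      rw [show (2 : ℕ) = 1 + 1 from rfl, lft_succ (by rw [hlen3]; omega)]; rfl
    have hinner : inner (rho (3 :: w)) n 2 = false :: (rho w).take (2 * r) := by
      rw [inner, hρ]; simp [hn]
    have hquot : quot (rho (3 :: w)) n 2 = rhoLetter 2 ++ (rho w).drop (2 * r) := by
      rw [quot, hρ, show 2 + n = [true, false, false].length + 2 * r by simp; omega, List.drop_append]
      simp [rhoLetter]
    rcases Nat.eq_zero_or_pos j with rfl | hjpos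
    · -- boundary of `w` at `2r`
      rw [Nat.add_zero] at hkj
      have hv : IsHoffman (w.take k) := hw'.take k
      have hrgt : rgt (rho (3 :: w)) n 2 = true := by
        rcases lt_or_eq_of_le hk with hk' | rfl
        · have h2 : 2 ≤ w[k] := two_le_of_isHoffman hw' (List.getElem_mem hk')
          have hlt : 2 * r < (rho w).length := by
            rw [hlen, ← hkj, ← weight_take_add_weight_drop w (k + 1), weight_take_succ hk']; omega
          rw [rgt_of_lt (by rw [hlen3]; omega)]
          have := getElem?_rho_weight_take_add hw' hk' (j := 0) (by omega)
          rw [Nat.add_zero, hkj, List.getElem?_eq_getElem hlt] at this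
          simp only [Option.some.injEq] at this
          rw [show (rho (3 :: w))[2 + n] = (rho w)[2 * r] by
            simp only [hρ]; rw [List.getElem_append_right (by simp; omega)]; congr 1; simp; omega]
          simpa using this
        · exact rgt_of_eq (by rw [List.take_length] at hkj; rw [hlen3]; omega)
      have hwterm : C.wterm r x (rho (3 :: w)) 2 =
          C.f r (C.J (false :: rho (w.take k))) • C.z (x ++ 2 :: w.drop k) := by
        rw [wterm, ← hn, hlft, hrgt, hinner, Im_false_true, hquot, ← hkj, take_rho_weight_take hw',
          drop_rho_weight_take hw', z, rho_append, rho_cons]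
      by_cases h0 : level (w.take k) = 0
      · -- `w↾k = 2^r`: the term is `gT1`
        have hpar := weight_eq_two_mul_length_add_level hv
        rw [hkj, h0, List.length_take, min_eq_left hk] at hpar
        have hkr : k = r := by omega
        subst hkr
        have htk := eq_replicate_two_of_level_eq_zero hv h0
        rw [List.length_take, min_eq_left hk] at htk
        have hg : C.gT1 k x (3 :: w) 0 = (2 * (-1 : ℚ) ^ k) • C.z (x ++ 2 :: w.drop k) := by
          rw [gT1, if_pos (hT1.2 ⟨hk, htk⟩)]
          simp [qT]
        rw [hwterm, hg, htk, C.f_zetaOne k hr, sub_self]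
        exact Submodule.zero_mem _
      · have hpar := weight_eq_two_mul_length_add_level hv
        rw [hkj, List.length_take, min_eq_left hk] at hpar
        have h2 : 2 ≤ level (w.take k) := by omega
        have hg : C.gT1 r x (3 :: w) 0 = 0 := by
          rw [gT1, if_neg]
          intro hT
          obtain ⟨hrle, htk⟩ := hT1.1 hT
          have hwr : weight (w.take r) = 2 * r := by rw [htk]; simp [weight, mul_comm]
          have := take_inj_of_weight_eq hw' hrle hk (hwr.trans hkj.symm)
          subst this
          rw [htk, level_replicate_two] at h0
          exact h0 rfl
        rw [hwterm, hg, sub_zero]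
        refine Submodule.smul_mem _ _ (C.z_mem_P (u := 2 :: w.drop k) (fun i hi => ?_) ?_ ?_)
        · simp only [List.mem_cons] at hi
          rcases hi with rfl | hi
          · exact Or.inl rfl
          · exact hw'.drop k i hi
        · have := weight_take_add_weight_drop w k
          rw [weight_cons, weight_cons]
          omega
        · have := level_take_add_level_drop w k
          simp only [level_cons_two, level_cons_three]
          omega
    · -- `2r` strictly inside a block of `w`: vanishes; `gT1 = 0`
      have hklt : k < w.length := lt_of_le_of_ne hk fun h => by have := hj2 h; omega
      have hjlt : j < w[k] := hj1 hklt
      have hlt : 2 * r < (rho w).length := by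
        rw [hlen, ← hkj, ← weight_take_add_weight_drop w (k + 1), weight_take_succ hklt]; omega
      have hrgt : rgt (rho (3 :: w)) n 2 = false := by
        rw [rgt_of_lt (by rw [hlen3]; omega)]
        have := getElem?_rho_weight_take_add hw' hklt hjlt
        rw [hkj, List.getElem?_eq_getElem hlt] at this
        simp only [Option.some.injEq] at this
        rw [show (rho (3 :: w))[2 + n] = (rho w)[2 * r] by
          simp only [hρ]; rw [List.getElem_append_right (by simp; omega)]; congr 1; simp; omega, this]
        simp [hjpos.ne']
      have hwterm : C.wterm r x (rho (3 :: w)) 2 = 0 := by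
        rw [wterm, ← hn, hlft, hrgt, Im_self _ _ (by rw [hinner]; simp), map_zero, zero_smul]
      have hg : C.gT1 r x (3 :: w) 0 = 0 := by
        rw [gT1, if_neg]
        intro hT
        obtain ⟨hrle, htk⟩ := hT1.1 hT
        have hwr : weight (w.take r) = 2 * r := by rw [htk]; simp [weight, mul_comm]
        exact weight_take_ne hklt hjpos hjlt r (hwr.trans hkj.symm)
      rw [hwterm, hg, sub_zero]
      exact Submodule.zero_mem _
  · rw [if_neg hwin]
    have hg : C.gT1 r x (3 :: w) 0 = 0 := by
      rw [gT1, if_neg]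
      intro hT
      obtain ⟨hrle, htk⟩ := hT1.1 hT
      have hwr : weight (w.take r) = 2 * r := by rw [htk]; simp [weight, mul_comm]
      have := weight_take_add_weight_drop w r
      rw [hlen3] at hwin
      omega
    rw [hg, sub_zero]
    exact Submodule.zero_mem _

/-- For a word starting with `2` there is no type-(2) window of the first kind at position `0`. [folklore] -/
theorem gT1_two_cons (r : ℕ) (x w : List ℕ) : C.gT1 r x (2 :: w) 0 = 0 := by
  rw [gT1, if_neg]
  simp [T1]

/-! ### Theorem 6.1 (word-level form): `D_{2r+1} ζᵐ(w)` modulo lower levels -/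

/-- **Brown 2012, Theorem 6.1 with Lemmas 5.5, 5.6, in exact word-level form.** For a Hoffman word
`w` and `r ≥ 1`, the `ζ_{2r+1}`-component of `D_{2r+1} ζᵐ(x·w)`-with-`x`-frozen, i.e. (3.4) summed
over the windows of `(0; ρ(w); 1)` with quotients prefixed by `ρ(x)`, equals
`∑_{w = uvy, deg₃ v = 1, |v| = 2r+1} (c_v - [y ≠ ∅] c_{ṽ}) ζᵐ(xuy) + ∑_{w = u 3 2^r y} c_{12^r} ζᵐ(xu2y)
 - ∑_{w = u 2^r 3 y} c_{12^r} ζᵐ(xu2y)` modulo the `ζᵐ(xu')` with `deg₃ u' ≤ deg₃ w - 2`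
(by induction on `w`, peeling off the first letter: the windows not starting inside the first block
are the windows of the rest). [cite: Brown2012, Theorem 6.1, Lemmas 5.5–5.6] -/
theorem lhs_sub_rhs_mem {r : ℕ} (hr : 1 ≤ r) {w : List ℕ} (hw : IsHoffman w) (x : List ℕ) :
    C.lhs r x w - C.rhs r x w ∈ C.P r x w := by
  induction w generalizing x with
  | nil =>
    have h1 : C.lhs r x [] = 0 := by
      rw [lhs, rho_nil, List.length_nil, show 0 + 1 - (2 * r + 1) = 0 by omega, Finset.sum_range_zero]
    have h2 : C.rhs r x [] = 0 := by
      rw [rhs, List.length_nil, Finset.sum_range_one, gK1, gK2, gT1, gT2, if_neg, if_neg, if_neg, if_neg]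
      · simp
      · simp [T2]
      · simp [T1]
      · rintro ⟨⟨h, -⟩, -⟩; simp at h; omega
      · rintro ⟨h, -⟩; simp at h; omega
    rw [h1, h2, sub_zero]
    exact Submodule.zero_mem _
  | cons c w ih =>
    have hc : c = 2 ∨ c = 3 := hw c (by simp)
    have hw' : IsHoffman w := fun i hi => hw i (by simp [hi])
    have hP := C.P_append_le x hc (ih hw' (x ++ [c]))
    have e0 := C.wterm_zero_sub_gK1_mem hw hr x
    have e1 := C.wterm_one_add_mem hw hr x
    rw [C.lhs_cons x (by omega) w, C.rhs_cons]
    rcases hc with rfl | rfl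
    · rw [sum_range_min_two, C.gT1_two_cons]
      convert Submodule.add_mem _ (Submodule.add_mem _ e0 e1) hP using 1
      abel
    · rw [sum_range_min_three]
      have e2 := C.wterm_two_sub_gT1_mem hw hr x
      have hT2 : C.gT2 r x (3 :: w) 0 = 0 := by
        rw [gT2, if_neg]
        simp only [T2, List.drop_zero, List.take_succ_cons]
        cases r with
        | zero => omega
        | succ r => simp [List.replicate_succ]
      rw [hT2] at e1
      convert Submodule.add_mem _ (Submodule.add_mem _ (Submodule.add_mem _ e0 e1) e2) hP using 1
      rw [hT2]
      abel

/-- **Brown's worked example (§5.5), the row `ζᵐ(3,3,2,2)` of `M_{10,2}`**, recomputed from the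
word-level right-hand side: `gr^F_2 D₃` gives `C₁₂ ζᵐ(3,2,2)` (the pairs `C₃ - C₃` cancel),
`gr^F_2 D₅` gives `(C₃₂ - C₂₃ + C₁₂₂) ζᵐ(3,2)`, and `gr^F_2 D₇` gives `C₃₂₂ ζᵐ(3)`; here with the
specialized coefficients `c_{12^r} = 2(-1)^r`, `c_v = coeffOfLevelOne v`.
[cite: Brown2012, §5.5] -/
theorem example_row_3322 :
    C.rhs 1 [] [3, 3, 2, 2] = (2 * (-1 : ℚ) ^ 1) • C.z [3, 2, 2] ∧
    C.rhs 2 [] [3, 3, 2, 2] =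
      (coeffOfLevelOne [3, 2] - coeffOfLevelOne [2, 3] + 2 * (-1 : ℚ) ^ 2) • C.z [3, 2] ∧
    C.rhs 3 [] [3, 3, 2, 2] = coeffOfLevelOne [3, 2, 2] • C.z [3] := by
  refine ⟨?_, ?_, ?_⟩
  · simp [rhs, Finset.sum_range_succ, gK1, gK2, gT1, gT2, K1, T1, T2, vK, qK, qT, level]
  · simp [rhs, Finset.sum_range_succ, gK1, gK2, gT1, gT2, K1, T1, T2, vK, qK, qT, level]
    module
  · simp [rhs, Finset.sum_range_succ, gK1, gK2, gT1, gT2, K1, T1, T2, vK, qK, qT, level]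

end CoactionData


/-! ### Three-part decompositions of a word -/

/-- `w = (w↾i) (w⇂i↾m) (w⇂(i+m))`. [folklore] -/
theorem take_drop_take_drop (w : List ℕ) (i m : ℕ) :
    w = w.take i ++ (w.drop i).take m ++ w.drop (i + m) := by
  conv_lhs => rw [← List.take_append_drop i w, ← List.take_append_drop m (w.drop i)]
  rw [List.drop_drop, List.append_assoc]

/-- Weight of a three-part decomposition. [folklore] -/
theorem weight_three_parts (w : List ℕ) (i m : ℕ) :
    weight w = weight (w.take i) + weight ((w.drop i).take m) + weight (w.drop (i + m)) := by
  conv_lhs => rw [take_drop_take_drop w i m]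
  simp only [weight, List.sum_append]

/-- Level of a three-part decomposition. [folklore] -/
theorem level_three_parts (w : List ℕ) (i m : ℕ) :
    level w = level (w.take i) + level ((w.drop i).take m) + level (w.drop (i + m)) := by
  conv_lhs => rw [take_drop_take_drop w i m]
  simp only [level_append]

/-- The quotient word of a type-(3) window is Hoffman. [folklore] -/
theorem isHoffman_qK {w : List ℕ} (hw : IsHoffman w) (r i : ℕ) : IsHoffman (qK w r i) := by
  intro a ha
  simp only [qK, List.mem_append] at ha
  rcases ha with ha | ha
  · exact hw a (List.mem_of_mem_take ha)
  · exact hw a (List.mem_of_mem_drop ha)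

/-- The quotient word of a type-(2) window is Hoffman. [folklore] -/
theorem isHoffman_qT {w : List ℕ} (hw : IsHoffman w) (r i : ℕ) : IsHoffman (qT w r i) := by
  intro a ha
  simp only [qT, List.mem_append, List.mem_cons] at ha
  rcases ha with ha | rfl | ha
  · exact hw a (List.mem_of_mem_take ha)
  · exact Or.inl rfl
  · exact hw a (List.mem_of_mem_drop ha)

/-- The quotient of a type-(3) window: weight `|w| - (2r+1)`, level `deg₃ w - 1`. [folklore] -/
theorem weight_qK_level_qK {w : List ℕ} (hw : IsHoffman w) {r i : ℕ} (hK : K1 w r i) :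
    weight (qK w r i) + (2 * r + 1) = weight w ∧ level (qK w r i) + 1 = level w := by
  obtain ⟨hle, hl1⟩ := hK
  have hv : weight (vK w r i) = 2 * r + 1 := by
    have := weight_eq_two_mul_length_add_level ((hw.drop i).take r)
    rw [vK] at hl1 ⊢
    rw [this, hl1, List.length_take, List.length_drop, min_eq_left (by omega)]
  refine ⟨?_, ?_⟩
  · rw [weight_three_parts w i r, qK, weight, List.sum_append, ← hv, vK]; unfold weight; ring
  · rw [level_three_parts w i r, qK, level_append, ← hl1, vK]; ring

/-- The quotient of a type-(2) window: weight `|w| - (2r+1)`, level `deg₃ w - 1`. [folklore] -/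
theorem weight_qT_level_qT {w : List ℕ} {r i : ℕ} (hT : T1 w r i ∨ T2 w r i) :
    weight (qT w r i) + (2 * r + 1) = weight w ∧ level (qT w r i) + 1 = level w := by
  have hv : weight ((w.drop i).take (r + 1)) = 2 * r + 3 ∧ level ((w.drop i).take (r + 1)) = 1 := by
    rcases hT with h | h
    · rw [T1] at h
      rw [h, weight_cons]
      simp [weight, level, List.count_replicate]
      ring
    · rw [T2] at h
      rw [h]
      simp [weight, level, List.count_append, List.count_replicate]
      ring
  refine ⟨?_, ?_⟩
  · rw [weight_three_parts w i (r + 1), qT, weight, List.sum_append, List.sum_cons, ← add_assoc i r 1]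
    unfold weight at hv ⊢
    omega
  · rw [level_three_parts w i (r + 1), qT, level_append, level_cons_two, hv.2, ← add_assoc i r 1]
    ring

namespace CoactionData

variable (C : CoactionData)

/-! ### Lemma 5.5 (level lowering) and Lemma 3.4 -/

/-- The right-hand side lies in the span of the `ζᵐ(u)`, `deg₃ u = deg₃ w - 1`, `|u| = |w| - (2r+1)`.
[cite: Brown2012, Lemma 5.6] -/
theorem rhs_mem_span {r : ℕ} {w : List ℕ} (hw : IsHoffman w) :
    C.rhs r [] w ∈ Submodule.span ℚ {h | ∃ u, IsHoffman u ∧ weight u + (2 * r + 1) = weight w ∧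
      level u + 1 ≤ level w ∧ h = C.z u} := by
  refine Submodule.sum_mem _ fun i _ => ?_
  refine Submodule.sub_mem _ (Submodule.add_mem _ (Submodule.sub_mem _ ?_ ?_) ?_) ?_
  · rw [gK1]
    split_ifs with h
    · obtain ⟨h1, h2⟩ := weight_qK_level_qK hw h
      exact Submodule.smul_mem _ _ (Submodule.subset_span ⟨_, isHoffman_qK hw r i, h1, h2.le, by simp⟩)
    · exact Submodule.zero_mem _
  · rw [gK2]
    split_ifs with h
    · obtain ⟨h1, h2⟩ := weight_qK_level_qK hw h.1
      exact Submodule.smul_mem _ _ (Submodule.subset_span ⟨_, isHoffman_qK hw r i, h1, h2.le, by simp⟩)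
    · exact Submodule.zero_mem _
  · rw [gT1]
    split_ifs with h
    · obtain ⟨h1, h2⟩ := weight_qT_level_qT (Or.inl h)
      exact Submodule.smul_mem _ _ (Submodule.subset_span ⟨_, isHoffman_qT hw r i, h1, h2.le, by simp⟩)
    · exact Submodule.zero_mem _
  · rw [gT2]
    split_ifs with h
    · obtain ⟨h1, h2⟩ := weight_qT_level_qT (Or.inr h)
      exact Submodule.smul_mem _ _ (Submodule.subset_span ⟨_, isHoffman_qT hw r i, h1, h2.le, by simp⟩)
    · exact Submodule.zero_mem _

/-- **Brown 2012, Lemma 5.5 (with Lemma 5.3), derived from (3.4):** `D_{2r+1}` maps `ζᵐ(w)`,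
`w ∈ {2,3}^×`, into the span of the `ζᵐ(u)`, `u ∈ {2,3}^×` of weight `|w| - 2r - 1` and level
`≤ deg₃ w - 1` ("it must necessarily contain at least one `00`, and so the associated quotient
sequence is of strictly smaller level"). [cite: Brown2012, Lemma 5.5] -/
theorem D_z_mem_span {r : ℕ} (hr : 1 ≤ r) {w : List ℕ} (hw : IsHoffman w) :
    C.D r (C.z w) ∈ Submodule.span ℚ {h | ∃ u, IsHoffman u ∧ weight u + (2 * r + 1) = weight w ∧
      level u + 1 ≤ level w ∧ h = C.z u} := by
  rw [C.D_z_eq_lhs hr, ← sub_add_cancel (C.lhs r [] w) (C.rhs r [] w)]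
  refine Submodule.add_mem _ ?_ (C.rhs_mem_span hw)
  refine (Submodule.span_mono ?_) (C.lhs_sub_rhs_mem hr hw [])
  rintro _ ⟨u, hu, hwt, hl, rfl⟩
  exact ⟨u, hu, hwt, by omega, by simp⟩

/-- **Brown 2012, Lemma 3.4 (the coaction part): `D_{2r+1} ζᵐ(2^{n}) = 0`** for all `r ≥ 1` ("for
reasons of parity, every strict subsequence of `(0; 1010…10; 1)` of odd length begins and ends in the
same symbol"). [cite: Brown2012, Lemma 3.4] -/
theorem D_z_replicate_two {r : ℕ} (hr : 1 ≤ r) (n : ℕ) : C.D r (C.z (List.replicate n 2)) = 0 := by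
  have h := C.D_z_mem_span hr (isHoffman_replicate_two n)
  rw [level_replicate_two] at h
  have h0 : {h : C.H | ∃ u, IsHoffman u ∧ weight u + (2 * r + 1) = weight (List.replicate n 2) ∧
      level u + 1 ≤ 0 ∧ h = C.z u} = ∅ := by
    ext x
    simp only [Set.mem_setOf_eq, Set.mem_empty_iff_false, iff_false, not_exists, not_and]
    intro u _ _ h
    omega
  rw [h0, Submodule.span_empty, Submodule.mem_bot] at h
  exact h

/-! ### The level data: `D r`, the matrix `E = M_{N,ℓ} - T_{N,ℓ}` and Theorem 6.1 -/

/-- `D r` for `r ≥ 1`, and `0` for `r = 0` (there is no `D₁`). [cite: Brown2012, Definition 5.7] -/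
def Dl (r : ℕ) : C.H →ₗ[ℚ] C.H := if r = 0 then 0 else C.D r

end CoactionData

/-- `r` of the column `u` of `M_{N,ℓ}`: `N = |u| + 2r + 1`. [cite: Brown2012, Definition 5.8] -/
def rOf (N : ℕ) (u : List ℕ) : ℕ := (N - weight u - 1) / 2

/-- The entry of the true matrix `M_{N,ℓ}` ((5.7), Definition 5.9) in row `w` and column `u`, read
off from the word-level form of Theorem 6.1. [cite: Brown2012, (5.7) and Definition 5.9] -/
def trueEntry (N : ℕ) (w u : List ℕ) : ℚ :=
  ∑ i ∈ Finset.range (w.length + 1),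
    ((if K1 w (rOf N u) i ∧ qK w (rOf N u) i = u then coeffOfLevelOne (vK w (rOf N u) i) else 0) -
      (if (K1 w (rOf N u) i ∧ i + rOf N u < w.length) ∧ qK w (rOf N u) i = u then
        coeffOfLevelOne (vK w (rOf N u) i).reverse else 0) +
      (if T1 w (rOf N u) i ∧ qT w (rOf N u) i = u then 2 * (-1 : ℚ) ^ rOf N u else 0) -
      (if T2 w (rOf N u) i ∧ qT w (rOf N u) i = u then 2 * (-1 : ℚ) ^ rOf N u else 0))

/-- `E = M_{N,ℓ} - T_{N,ℓ} = μ(M^f_{N,ℓ} - T^f_{N,ℓ})`. [cite: Brown2012, Theorem 6.1] -/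
def Emat (N ℓ : ℕ) : Matrix (ColWord N ℓ)ᵒᵈ (ColWord N ℓ)ᵒᵈ ℚ :=
  Matrix.of fun i j => trueEntry N (phi N (OrderDual.ofDual i).1) (OrderDual.ofDual j).1 -
    levelMatrix N ℓ i j

/-- `c_v - c_{ṽ} ∈ 2ℤ` for a level-one word (Corollary 4.4 (1)). [cite: Brown2012, Corollary 4.4 (1)] -/
theorem coeffOfLevelOne_sub_reverse {v : List ℕ} (hv : IsHoffman v) (h1 : level v = 1) :
    ∃ m : ℤ, coeffOfLevelOne v - coeffOfLevelOne v.reverse = 2 * m := by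
  obtain ⟨a, b, rfl, -⟩ := eq_twos_three_twos_of_level_eq_one hv h1
  rw [reverse_replicate_append_three, coeffOfLevelOne_eq, coeffOfLevelOne_eq]
  exact zagierCoeff_sub_zagierCoeff_swap a b

/-- An even integer is `0` or has `v₂ ≥ 1`. [folklore] -/
theorem two_mul_int_zero_or_le (m : ℤ) : (2 * m : ℚ) = 0 ∨ 1 ≤ padicValRat 2 (2 * m : ℚ) := by
  by_cases hm : m = 0
  · left; simp [hm]
  · right
    have h2 : padicValRat 2 (2 : ℚ) = 1 := by
      rw [show (2 : ℚ) = ((2 : ℕ) : ℚ) by norm_num, padicValRat.of_nat]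
      simp
    rw [padicValRat.mul (by norm_num) (by exact_mod_cast hm), h2, padicValRat.of_int]
    have := padicValInt 2 m
    omega

/-- **Theorem 6.1 ⟹ the entries of `E = M - T` are even integers** (`μ(I) ⊆ 2ℤ`): in a column `u`,
the true entry minus the deconcatenation entry is a sum of `c_v - c_{ṽ}` over neighbouring pairs of
type-(3) windows (Corollary 4.4 (1)) and of `± c_{12^r} = ± 2(-1)^r` (Lemma 3.8).
[cite: Brown2012, Theorem 6.1 and proof of Theorem 7.3] -/
theorem trueEntry_sub_deconcEntry {N ℓ : ℕ} (u' u : ColWord N ℓ) :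
    ∃ m : ℤ, trueEntry N (phi N u'.1) u.1 - deconcEntry (phi N u'.1) u.1 = 2 * m := by
  set w := phi N u'.1 with hw_def
  obtain ⟨hw, hwN, hwl⟩ := phi_mem u'
  rw [← hw_def] at hw hwN hwl
  set r := rOf N u.1 with hr_def
  have hru : weight u.1 + (2 * r + 1) = N := by
    have h1 := u.2.2.2.1
    have h2 := u.2.2.2.2
    rw [hr_def, rOf]
    omega
  -- each summand minus its diagonal part is even
  have key : ∀ i, ∃ m : ℤ,
      ((if K1 w r i ∧ qK w r i = u.1 then coeffOfLevelOne (vK w r i) else 0) -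
        (if (K1 w r i ∧ i + r < w.length) ∧ qK w r i = u.1 then coeffOfLevelOne (vK w r i).reverse
          else 0) +
        (if T1 w r i ∧ qT w r i = u.1 then 2 * (-1 : ℚ) ^ r else 0) -
        (if T2 w r i ∧ qT w r i = u.1 then 2 * (-1 : ℚ) ^ r else 0)) -
      (if (K1 w r i ∧ i + r = w.length) ∧ qK w r i = u.1 then coeffOfLevelOne (vK w r i) else 0) =
        2 * m := by
    intro i
    have hT : ∃ m : ℤ, (if T1 w r i ∧ qT w r i = u.1 then 2 * (-1 : ℚ) ^ r else 0) -
        (if T2 w r i ∧ qT w r i = u.1 then 2 * (-1 : ℚ) ^ r else 0) = 2 * m := by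
      by_cases h1 : T1 w r i ∧ qT w r i = u.1 <;> by_cases h2 : T2 w r i ∧ qT w r i = u.1
      · exact ⟨0, by rw [if_pos h1, if_pos h2]; ring⟩
      · exact ⟨(-1) ^ r, by rw [if_pos h1, if_neg h2]; push_cast; ring⟩
      · exact ⟨-(-1) ^ r, by rw [if_neg h1, if_pos h2]; push_cast; ring⟩
      · exact ⟨0, by rw [if_neg h1, if_neg h2]; ring⟩
    obtain ⟨mT, hmT⟩ := hT
    by_cases hK : K1 w r i ∧ qK w r i = u.1
    · have hle : i + r ≤ w.length := hK.1.1
      have eA : (if K1 w r i ∧ qK w r i = u.1 then coeffOfLevelOne (vK w r i) else 0) =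
          coeffOfLevelOne (vK w r i) := if_pos hK
      rcases lt_or_eq_of_le hle with hlt | heq
      · obtain ⟨m, hm⟩ := coeffOfLevelOne_sub_reverse ((hw.drop i).take r) hK.1.2
        have eB : (if (K1 w r i ∧ i + r < w.length) ∧ qK w r i = u.1 then
            coeffOfLevelOne (vK w r i).reverse else 0) = coeffOfLevelOne (vK w r i).reverse :=
          if_pos ⟨⟨hK.1, hlt⟩, hK.2⟩
        have eD : (if (K1 w r i ∧ i + r = w.length) ∧ qK w r i = u.1 then
            coeffOfLevelOne (vK w r i) else 0) = 0 := if_neg (by rintro ⟨⟨-, h⟩, -⟩; omega)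
        refine ⟨m + mT, ?_⟩
        rw [eA, eB, eD, vK]
        push_cast
        linear_combination hm + hmT
      · have eB : (if (K1 w r i ∧ i + r < w.length) ∧ qK w r i = u.1 then
            coeffOfLevelOne (vK w r i).reverse else 0) = 0 := if_neg (by rintro ⟨⟨-, h⟩, -⟩; omega)
        have eD : (if (K1 w r i ∧ i + r = w.length) ∧ qK w r i = u.1 then
            coeffOfLevelOne (vK w r i) else 0) = coeffOfLevelOne (vK w r i) := if_pos ⟨⟨hK.1, heq⟩, hK.2⟩
        refine ⟨mT, ?_⟩
        rw [eA, eB, eD]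
        linear_combination hmT
    · have eA : (if K1 w r i ∧ qK w r i = u.1 then coeffOfLevelOne (vK w r i) else 0) = 0 := if_neg hK
      have eB : (if (K1 w r i ∧ i + r < w.length) ∧ qK w r i = u.1 then
          coeffOfLevelOne (vK w r i).reverse else 0) = 0 :=
        if_neg (by rintro ⟨⟨h, -⟩, h'⟩; exact hK ⟨h, h'⟩)
      have eD : (if (K1 w r i ∧ i + r = w.length) ∧ qK w r i = u.1 then
          coeffOfLevelOne (vK w r i) else 0) = 0 :=
        if_neg (by rintro ⟨⟨h, -⟩, h'⟩; exact hK ⟨h, h'⟩)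
      refine ⟨mT, ?_⟩
      rw [eA, eB, eD]
      linear_combination hmT
  choose m hm using key
  -- the diagonal part is the deconcatenation entry
  have hdiag : ∑ i ∈ Finset.range (w.length + 1),
      (if (K1 w r i ∧ i + r = w.length) ∧ qK w r i = u.1 then coeffOfLevelOne (vK w r i) else 0) =
        deconcEntry w u.1 := by
    rw [Finset.sum_eq_single (w.length - r)]
    · rw [deconcEntry]
      by_cases hp : u.1 <+: w ∧ level (w.drop u.1.length) = 1
      · -- the deconcatenation `w = u v`
        rw [if_pos hp]
        have hlen : weight (w.drop u.1.length) = 2 * r + 1 := by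
          have := weight_take_add_weight_drop w u.1.length
          rw [← List.prefix_iff_eq_take.1 hp.1] at this
          omega
        have hdl : (w.drop u.1.length).length = r := by
          have := weight_eq_two_mul_length_add_level (hw.drop u.1.length)
          rw [hlen, hp.2] at this
          omega
        have hul : u.1.length + r = w.length := by
          have := hp.1.length_le
          rw [List.length_drop] at hdl
          omega
        have hi : w.length - r = u.1.length := by omega
        rw [hi]
        have hv : vK w r u.1.length = w.drop u.1.length := by
          rw [vK, List.take_of_length_le (by rw [hdl])]
        rw [if_pos ⟨⟨⟨by omega, by rw [hv]; exact hp.2⟩, hul⟩, by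
          rw [qK, hul, List.drop_length, List.append_nil]; exact (List.prefix_iff_eq_take.1 hp.1).symm⟩, hv]
      · rw [if_neg hp, if_neg]
        rintro ⟨⟨⟨hle, hl1⟩, heq⟩, hq⟩
        apply hp
        have hq' : u.1 = w.take (w.length - r) := by
          rw [← hq, qK, heq, List.drop_length, List.append_nil]
        have hul : u.1.length = w.length - r := by rw [hq']; simp
        refine ⟨by rw [hq']; exact List.take_prefix _ _, ?_⟩
        rw [hul, ← List.take_of_length_le (l := w.drop (w.length - r)) (i := r) (by rw [List.length_drop]; omega)]
        exact hl1
    · intro i _ hi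
      rw [if_neg]
      rintro ⟨⟨-, h⟩, -⟩
      exact hi (by omega)
    · intro h
      simp at h
  refine ⟨∑ i ∈ Finset.range (w.length + 1), m i, ?_⟩
  rw [trueEntry, ← hr_def, ← hdiag, ← Finset.sum_sub_distrib, Finset.sum_congr rfl fun i _ => hm i]
  push_cast
  rw [← Finset.mul_sum]

/-- `E` has entries in `2ℤ`: `0` or of `2`-adic valuation `≥ 1`. [cite: Brown2012, proof of Theorem 7.3] -/
theorem Emat_small (N ℓ : ℕ) (i j : (ColWord N ℓ)ᵒᵈ) :
    Emat N ℓ i j = 0 ∨ 1 ≤ padicValRat 2 (Emat N ℓ i j) := by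
  obtain ⟨m, hm⟩ := trueEntry_sub_deconcEntry (OrderDual.ofDual i) (OrderDual.ofDual j)
  rw [Emat, Matrix.of_apply, levelMatrix_apply, hm]
  exact two_mul_int_zero_or_le m

namespace CoactionData

variable (C : CoactionData)

/-- A summand of `rhs` equals the corresponding column sum. [folklore] -/
theorem sum_ite_smul_eq {N ℓ : ℕ} {w : List ℕ} (hwN : weight w = N) (hwl : level w = ℓ) {r : ℕ}
    (hr : 1 ≤ r)
    (P : Prop) [Decidable P] (q : List ℕ) (c : ℚ)
    (hq : P → IsHoffman q ∧ weight q + (2 * r + 1) = weight w ∧ level q + 1 = level w) :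
    (∑ u ∈ Finset.univ.filter (fun u : ColWord N ℓ => weight u.1 + (2 * r + 1) = N),
        (if P ∧ q = u.1 then c else 0) • C.z u.1) = if P then c • C.z q else 0 := by
  classical
  by_cases hP : P
  · obtain ⟨hq1, hq2, hq3⟩ := hq hP
    let uq : ColWord N ℓ := ⟨q, hq1, by omega, by omega, by omega⟩
    rw [if_pos hP, Finset.sum_eq_single uq]
    · simp [uq, hP]
    · intro u _ hu
      rw [if_neg, zero_smul]
      rintro ⟨-, h⟩
      exact hu (Subtype.ext h.symm)
    · intro h
      exact absurd (Finset.mem_filter.2 ⟨Finset.mem_univ _, by simp [uq]; omega⟩) h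
  · rw [if_neg hP]
    refine Finset.sum_eq_zero fun u _ => ?_
    rw [if_neg (fun h => hP h.1), zero_smul]

/-- **Theorem 6.1 in matrix form**: in the row of `w = u' 3 2^{r'-1}`,
`D r (ζᵐ(w)) ≡ ∑_u (T_{N,ℓ} + E)_{u',u} ζᵐ(u)` modulo level `< ℓ - 1`. [cite: Brown2012, Theorem 6.1] -/
theorem matrix_eq' (N ℓ : ℕ) (hℓ : 1 ≤ ℓ) (u' : ColWord N ℓ) (r : ℕ) :
    C.Dl r (C.z (phi N u'.1)) -
      ∑ u ∈ Finset.univ.filter (fun u : ColWord N ℓ => weight u.1 + (2 * r + 1) = N),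
        (levelMatrix N ℓ + Emat N ℓ) (OrderDual.toDual u') (OrderDual.toDual u) • C.z u.1 ∈
      levelSpan C.z (N - (2 * r + 1)) (ℓ - 1) := by
  classical
  set w := phi N u'.1 with hw_def
  obtain ⟨hw, hwN, hwl⟩ := phi_mem u'
  rw [← hw_def] at hw hwN hwl
  rcases Nat.eq_zero_or_pos r with rfl | hr
  · -- `r = 0`: no columns, `D 0 = 0`
    have hS : Finset.univ.filter (fun u : ColWord N ℓ => weight u.1 + (2 * 0 + 1) = N) = ∅ := by
      refine Finset.filter_eq_empty_iff.2 fun u _ h => ?_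
      have := u.2.2.2.1
      omega
    rw [hS, Finset.sum_empty, sub_zero, Dl, if_pos rfl, LinearMap.zero_apply]
    exact Submodule.zero_mem _
  · set S := Finset.univ.filter (fun u : ColWord N ℓ => weight u.1 + (2 * r + 1) = N) with hS
    have hent : ∀ u ∈ S, (levelMatrix N ℓ + Emat N ℓ) (OrderDual.toDual u') (OrderDual.toDual u) =
        trueEntry N w u.1 ∧ rOf N u.1 = r := by
      intro u hu
      have hu' := (Finset.mem_filter.1 hu).2
      refine ⟨?_, by rw [rOf]; omega⟩
      rw [Matrix.add_apply, Emat, Matrix.of_apply, OrderDual.ofDual_toDual, OrderDual.ofDual_toDual,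
        ← hw_def, add_sub_cancel]
    have hsum : ∑ u ∈ S, (levelMatrix N ℓ + Emat N ℓ) (OrderDual.toDual u') (OrderDual.toDual u) •
        C.z u.1 = C.rhs r [] w := by
      rw [Finset.sum_congr rfl fun u hu => by rw [(hent u hu).1, trueEntry, (hent u hu).2]]
      simp_rw [Finset.sum_smul]
      rw [Finset.sum_comm, rhs]
      refine Finset.sum_congr rfl fun i _ => ?_
      simp_rw [sub_smul, add_smul, sub_smul]
      rw [Finset.sum_sub_distrib, Finset.sum_add_distrib, Finset.sum_sub_distrib,
        C.sum_ite_smul_eq hwN hwl hr _ _ _ (fun h => ⟨isHoffman_qK hw r i, weight_qK_level_qK hw h⟩),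
        C.sum_ite_smul_eq hwN hwl hr _ _ _ (fun h => ⟨isHoffman_qK hw r i, weight_qK_level_qK hw h.1⟩),
        C.sum_ite_smul_eq hwN hwl hr _ _ _
          (fun h => ⟨isHoffman_qT hw r i, weight_qT_level_qT (Or.inl h)⟩),
        C.sum_ite_smul_eq hwN hwl hr _ _ _
          (fun h => ⟨isHoffman_qT hw r i, weight_qT_level_qT (Or.inr h)⟩)]
      simp [gK1, gK2, gT1, gT2]
    rw [hsum, Dl, if_neg (by omega), C.D_z_eq_lhs hr]
    refine (Submodule.span_mono ?_) (C.lhs_sub_rhs_mem hr hw [])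
    rintro _ ⟨u, hu, hwt, hl, rfl⟩
    exact ⟨⟨u, hu, by omega, by omega⟩, by simp⟩

/-- **Lemma 5.5 in the form of `LevelData.level_lowering`.** [cite: Brown2012, Lemma 5.5] -/
theorem level_lowering' (r N ℓ : ℕ) :
    (levelSpan C.z N (ℓ + 1)).map (C.Dl r) ≤ levelSpan C.z (N - (2 * r + 1)) ℓ := by
  rcases Nat.eq_zero_or_pos r with rfl | hr
  · rw [Dl, if_pos rfl, Submodule.map_zero]
    exact bot_le
  rw [Dl, if_neg (by omega), levelSpan, Submodule.map_span, Submodule.span_le]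
  rintro _ ⟨_, ⟨w, rfl⟩, rfl⟩
  refine (Submodule.span_mono ?_) (C.D_z_mem_span hr w.2.1)
  rintro _ ⟨u, hu, hwt, hl, rfl⟩
  have h1 := w.2.2.1
  have h2 := w.2.2.2
  exact ⟨⟨u, hu, by omega, by omega⟩, rfl⟩

/-- **From coaction data to level data** (Brown 2012, §§3.1, 5, 6 formalized): the operators
`D r = (ζ_{2r+1} ↦ 1) ∘ D_{2r+1}` given by Goncharov's formula (3.4), with the coefficient facts
(3.12)/(4.2) and Lemma 3.8, satisfy Lemma 5.5 (level lowering) and Theorem 6.1 (the matrix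
`T_{N,ℓ} + E` with `E` even) — the hypotheses of `Brown2012.LevelData`, hence Theorem 7.4.
[cite: Brown2012, Lemma 5.5, Theorem 6.1] -/
def toLevelData : LevelData where
  H := C.H
  z := C.z
  D := C.Dl
  level_lowering := C.level_lowering'
  E := Emat
  E_small := Emat_small
  matrix_eq := C.matrix_eq'
  z_replicate_two_ne_zero := C.J_rho_replicate_two_ne_zero

/-- **Theorem 7.4 from the coaction**: the `ζᵐ(w)`, `w ∈ {2,3}^×` of weight `N`, are linearly
independent. [cite: Brown2012, Theorem 7.4] -/
theorem linearIndependent_hoffman (N : ℕ) :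
    LinearIndependent ℚ fun w : {w : List ℕ // IsHoffman w ∧ weight w = N} => C.z w.1 :=
  C.toLevelData.linearIndependent_hoffman N

end CoactionData


/-! ### Consistency: the free coaction model -/

/-- `ρ` is injective on Hoffman words. [folklore] -/
theorem rho_injective_hoffman : ∀ {u v : List ℕ}, IsHoffman u → IsHoffman v → rho u = rho v → u = v
  | [], [], _, _, _ => rfl
  | [], b :: v, _, _, h => by simp [rhoLetter] at h
  | a :: u, [], _, _, h => by simp [rhoLetter] at h
  | a :: u, b :: v, hu, hv, h => by
      have hu' : IsHoffman u := fun i hi => hu i (by simp [hi])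
      have hv' : IsHoffman v := fun i hi => hv i (by simp [hi])
      rcases hu a (by simp) with rfl | rfl <;> rcases hv b (by simp) with rfl | rfl
      · simp only [rho_cons, rhoLetter_two, List.cons_append, List.cons.injEq, List.nil_append,
          true_and] at h
        rw [rho_injective_hoffman hu' hv' h]
      · exfalso
        simp only [rho_cons, rhoLetter_two, rhoLetter_three, List.cons_append, List.cons.injEq,
          List.nil_append, true_and] at h
        rcases u with _ | ⟨c, u⟩
        · simp at h
        · simp [rhoLetter] at h
      · exfalso
        simp only [rho_cons, rhoLetter_two, rhoLetter_three, List.cons_append, List.cons.injEq,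
          List.nil_append, true_and] at h
        rcases v with _ | ⟨c, v⟩
        · simp at h
        · simp [rhoLetter] at h
      · simp only [rho_cons, rhoLetter_three, List.cons_append, List.cons.injEq, List.nil_append,
          true_and] at h
        rw [rho_injective_hoffman hu' hv' h]

/-- `2^a 3 2^b` is a Hoffman word. [folklore] -/
theorem isHoffman_twos_three_twos (a b : ℕ) : IsHoffman (List.replicate a 2 ++ 3 :: List.replicate b 2) := by
  intro i hi
  simp only [List.mem_append, List.mem_cons, List.mem_replicate] at hi
  rcases hi with ⟨-, rfl⟩ | rfl | ⟨-, rfl⟩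
  · exact Or.inl rfl
  · exact Or.inr rfl
  · exact Or.inl rfl

/-- The prescribed values of the coefficient functional `f r` on binary words in the free model:
`c_{2^a32^b}` on `ρ(2^a 3 2^b)` (`a + b + 1 = r`), `c_{12^r}` on `0 ρ(2^r)`, `0` elsewhere.
[cite: Brown2012, (3.12), (4.2), Lemma 3.8] -/
def freeFVal (r : ℕ) (u : List Bool) : ℚ :=
  (∑ a ∈ Finset.range r, if u = rho (List.replicate a 2 ++ 3 :: List.replicate (r - 1 - a) 2) then
      zagierCoeff a (r - 1 - a) else 0) +
    (if u = false :: rho (List.replicate r 2) then 2 * (-1 : ℚ) ^ r else 0)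

/-- `freeFVal r (ρ(2^a 3 2^b)) = zagierCoeff a b` for `r = a + b + 1`. [folklore] -/
theorem freeFVal_rho (a b : ℕ) :
    freeFVal (a + b + 1) (rho (List.replicate a 2 ++ 3 :: List.replicate b 2)) = zagierCoeff a b := by
  rw [freeFVal, Finset.sum_eq_single a, if_pos (by rw [show a + b + 1 - 1 - a = b by omega]),
    show a + b + 1 - 1 - a = b by omega, if_neg, add_zero]
  · obtain ⟨t, ht⟩ := rho_eq_true_cons (w := List.replicate a 2 ++ 3 :: List.replicate b 2) (by simp)
    rw [ht]
    simp
  · intro a' _ ha'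
    rw [if_neg]
    intro h
    have := rho_injective_hoffman (isHoffman_twos_three_twos _ _) (isHoffman_twos_three_twos _ _) h
    have := (replicate_two_append_three_inj this).1
    exact ha' this.symm
  · intro h
    simp at h

/-- `freeFVal r (0 ρ(2^r)) = 2(-1)^r`. [folklore] -/
theorem freeFVal_zetaOne (r : ℕ) : freeFVal r (false :: rho (List.replicate r 2)) = 2 * (-1) ^ r := by
  rw [freeFVal, if_pos rfl, Finset.sum_eq_zero, zero_add]
  intro a _
  rw [if_neg]
  obtain ⟨t, ht⟩ := rho_eq_true_cons (w := List.replicate a 2 ++ 3 :: List.replicate (r - 1 - a) 2)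
    (by simp)
  rw [ht]
  simp

/-- **The free coaction model** (consistency of `CoactionData`): `H = ℚ^{(binary words)}`,
`J u = e_u`, `f r` the functional with the prescribed values `c_{2^a32^b}`, `c_{12^r}` on the words
`ρ(2^a32^b)`, `0ρ(2^r)` and `0` elsewhere, and `D r` DEFINED on the basis by formula (3.4). All the
axioms hold by construction, so they are jointly consistent (and, by `toLevelData`, give another
model of `LevelData`, this time with `E ≠ 0`). Of course it is not Brown's `H` (no relations).
[cite: Brown2012, (3.4)] -/
noncomputable def freeCoactionData : CoactionData where
  H := List Bool →₀ ℚ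
  J := fun u => Finsupp.single u 1
  f := fun r => Finsupp.linearCombination ℚ (freeFVal r)
  D := fun r => Finsupp.linearCombination ℚ fun v =>
    ∑ p ∈ Finset.range (v.length + 1 - (2 * r + 1)),
      Finsupp.linearCombination ℚ (freeFVal r)
          (Im (fun u => Finsupp.single u (1 : ℚ)) (lft v p) (inner v (2 * r + 1) p)
            (rgt v (2 * r + 1) p)) •
        Finsupp.single (quot v (2 * r + 1) p) (1 : ℚ)
  coaction := fun r _ v => by simp only [Finsupp.linearCombination_single, one_smul]
  f_levelOne := fun a b => by
    rw [Finsupp.linearCombination_single, one_smul]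
    exact freeFVal_rho a b
  f_zetaOne := fun r _ => by
    rw [Finsupp.linearCombination_single, one_smul]
    exact freeFVal_zetaOne r
  J_rho_replicate_two_ne_zero := fun n => by simp

/-- In the free model the conclusion of Theorem 7.4 (trivially true there) is an instance of the
general theorem. [folklore] -/
theorem freeCoactionData_linearIndependent (N : ℕ) :
    LinearIndependent ℚ fun w : {w : List ℕ // IsHoffman w ∧ weight w = N} =>
      freeCoactionData.z w.1 :=
  freeCoactionData.linearIndependent_hoffman N


/-! ### Brown's motivic coaction data and the named fact -/

/-- **Brown's motivic data, coaction form**: coaction data together with the period map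
`per : H → ℝ` ((2.11)) with `per (ζᵐ(n₁,…,n_r)) = ζ(n₁,…,n_r)` ((2.19); Brown's order of the
arguments, the tree's `multipleZeta` summing in the reverse order: `per (J (ρ s.reverse)) =
multipleZeta s` for `s` admissible), and finite-dimensional weight pieces `H_N ⊆ H_N^{MT⁺}`
containing the `ζᵐ` of weight `N`, of dimension `≤ d_N` ((2.23), Deligne–Goncharov).
[cite: Brown2012, §2 (2.11), (2.19), (2.23)] -/
structure MotivicCoactionData extends CoactionData where
  /-- The period map (2.11). -/
  per : H →ₗ[ℚ] ℝ
  /-- (2.19): `per (ζᵐ(n₁,…,n_r)) = ζ(n₁,…,n_r)`, i.e. `per (J (ρ s.reverse)) = multipleZeta s`. -/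
  per_J : ∀ s : List ℕ, IsAdmissible s → per (J (rho s.reverse)) = multipleZeta s
  /-- The weight-`N` piece `H_N ⊆ H_N^{MT⁺}`. -/
  V : ℕ → Submodule ℚ H
  /-- `ζᵐ ∈ H_N` in weight `N`. -/
  J_mem : ∀ s : List ℕ, IsAdmissible s → J (rho s.reverse) ∈ V (weight s)
  /-- `H_N` is finite-dimensional … -/
  finiteDimensional : ∀ N, FiniteDimensional ℚ (V N)
  /-- … of dimension `≤ d_N` ((2.23)). -/
  finrank_le : ∀ N, Module.finrank ℚ (V N) ≤ zagierDim N

/-- Motivic coaction data give motivic data (the level data now being derived, not assumed).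
[cite: Brown2012, §§5–7] -/
def MotivicCoactionData.toMotivicData (M : MotivicCoactionData) : MotivicData where
  toLevelData := M.toCoactionData.toLevelData
  per := M.per
  per_z := M.per_J
  V := M.V
  z_mem := M.J_mem
  finiteDimensional := M.finiteDimensional
  finrank_le := M.finrank_le

end Brown2012

/-- **The named fact from Brown's coaction data** (Brown 2012, Theorem 1.1 ⟹ Conjecture 2, with
§§3.1, 5, 6, 7 formal): motivic iterated integrals with Goncharov's coaction (3.4), the depth-one
coefficients (3.12)/(4.2)/Lemma 3.8, `ζᵐ(2^n) ≠ 0`, the period map and `dim H_N ≤ d_N` imply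
`hoffmanSpan_eq_mzvSpace` — via Lemma 5.5 and Theorem 6.1 (this file), Theorems 7.3, 7.4 and
Corollary 7.5 (`BrownLevelMatrices`, `BrownLinearIndependence`, `BrownHoffmanModel`).
[cite: Brown2012, Theorem 1.1] -/
theorem hoffmanSpan_eq_mzvSpace_of_motivicCoactionData (M : Brown2012.MotivicCoactionData) :
    hoffmanSpan_eq_mzvSpace :=
  hoffmanSpan_eq_mzvSpace_of_motivicData M.toMotivicData

end Literature.NumberTheory.Transcendental
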